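import Literature.MathematicalPhysics.QuantumManyBody.LiebSimpleEquationExistence
import Literature.MathematicalPhysics.QuantumManyBody.LiebSimpleEquationFactsProofs
import Literature.MathematicalPhysics.QuantumManyBody.LiebSimpleEquationDecayErratum
import Literature.MathematicalPhysics.QuantumManyBody.LeeHuangYangIntegral
import Literature.Analysis.Fourier.FourierUniquenessL1
import Mathlib.Analysis.Fourier.Inversion
import HarnessLib

/-!
# Lieb's simple equation (Carlen–Jauslin–Lieb): proof of CJL-I Theorem 2 (the energy asymptotics)

Topic: `Literature/MathematicalPhysics/QuantumManyBody`. This file DISCHARGES the named fact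
`CarlenJauslinLieb2020_thm2` of `LiebSimpleEquationFacts.lean`:
`theorem CarlenJauslinLieb2020_thm2_holds : CarlenJauslinLieb2020_thm2` — CJL-I Theorem 2
(Carlen–Jauslin–Lieb, *Analysis of a simple equation for the ground state energy of the Bose gas*,
Pure Appl. Anal. 2 (2020) 659–684, arXiv:1912.04987, Theorem 2 with its proof in §3): for
`𝒱 ≥ 0` integrable and square-integrable on `ℝ³`, `𝒱 ≢ 0`, (1) for each `ρ > 0` there is `e > 0`
with a solution at `(ρ, e)`; (2) low density: `e = 2πρa(1 + (128/(15√π))√(ρa³) + o(√ρ))`,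
`4πa = ∫𝒱(1 − φ)` for the zero-energy scattering solution `φ`; (3) high density:
`e = (ρ/2)∫𝒱 + o(ρ)`. Parts (1) and (3) are the theorems `CarlenJauslinLieb2020_thm2_exists_of_thm1`
(with `CarlenJauslinLieb2020_thm1_holds` of `LiebSimpleEquationExistence.lean`) and
`CarlenJauslinLieb2020_thm2_highDensity` of `LiebSimpleEquationFactsProofs.lean`; this file proves
(2), i.e. CJL-I §3.2 (Lemmas 10–11), and assembles the fact.

## The printed proof (CJL-I §3.2, Lemma 11) and how it is followed

With `w := G_0((1 − u)𝒱)` (`G_0 = (−Δ)⁻¹ = Y_0∗`, (3.12)) and `e_w := (ρ/2)∫(1 − w)𝒱`, CJL prove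
(eew) `e − e_w = (16√2/(15π²))e^{3/2}∫𝒱 + o(ρ^{3/2})` and (ewephi)
`e_w − 2πρa = −(16√2/(15π²))e^{3/2}∫φ𝒱 + o(ρ^{3/2})`, whose sum is the claim. For (eew) the
equation is solved in Fourier space, `ρû = A − √(A² − S)`, `A = k²/4e + 1`, `S = (ρ/2e)∫e^{ikx}(1 − u)𝒱`
((3.20)–(3.22)), `û − ŵ` is inverted ((3.23)–(3.24)) and the limit `e → 0` is taken by dominated
convergence with `S(k) → S(0) = 1` ((3.25)–(3.31)); the constant is the integral (3.28). For
(ewephi) the symmetry of `(−Δ + 𝒱)⁻¹` gives `∫𝒱ψ = ∫φ(u − w)𝒱` for `ψ = w − φ` ((3.34)–(3.37)),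
and dominated convergence again ((3.38)).

Everything below is in Mathlib's convention `𝓕f(ξ) = ∫e^{-2πi⟨x,ξ⟩}f` (`k = 2πξ`, CJL's
`k̃ = k/(2√e)` is `π ξ/√e`; the substitution used here is `ξ = (√e/π)k`, so `A = 1 + |k|²`).

* §A `ae_eq_fourierInv_fourier` — Fourier inversion a.e. for `f, 𝓕f ∈ L¹` (duality against
  Schwartz functions, `Literature.Analysis.Fourier.integral_fourier_smul_eq_of_integrable`).
* §B the Newton potential and the scattering solution `φ = sup_k K_{4/(k+1)}𝒱` (the object of
  `lowEnergy_L_ne_zero` in the existence file): `φ = G_0(𝒱(1 − φ))` by monotone convergence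
  (`scat_mild`), `IsScatteringSolution 𝒱 φ` (`isScatteringSolution_scat`), `4πa = ∫𝒱(1 − φ) =: ℓ > 0`
  (CJL-I Lemma 10 / (3.11) is the DEFINITION of `a` in the tree's rendering), a uniform bound on
  `G_0𝒱` (`newton_pot_le`), and the a priori bound `ρ ≤ 4e/ℓ` for every solution triple
  (`IsSolution.rho_le_of_pos`, by uniqueness, CJL-I Lemma 7, and `fam_rho_le`).
* §C a solution triple in Fourier space: the quadratic relation `2AÛ = ŝ + Û²` for `Û = ρû`,
  `ŝ = (ρ/2e)T̂`, `T = (1 − u)𝒱` (`IsSolution.quad_relation`, from `IsSolution.fourier_eq` of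
  `LiebSimpleEquationDecayErratum.lean`); the bound `|Û − ŝ/(2(A−1))| ≤ 3/(2A(A−1))`
  (`quad_root_estimate`); `F := û − T̂/(4π²|ξ|²) ∈ L¹` (`IsSolution.integrable_F`);
  `u − w_δ = 𝓕⁻F_δ` a.e. for the Yukawa-regularised `w_δ = Y_δ∗T` (`IsSolution.D_ae_eq`, the
  convolution theorem and `fourier_yukawa`), and `u − w = 𝓕⁻F` a.e. by letting `δ = 4/(k+1) → 0`
  (`IsSolution.ae_repr`; monotone convergence in `x`, dominated convergence in `ξ`).
* §D the energy identity `e − 2πρa = (ρ/2)∫(1 − φ)𝒱(w − u)` (`IsSolution.energy_sub_eq`): (3.18)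
  and (3.34)–(3.37), the symmetry step being Tonelli for `G_0` (`lintegral_mul_G_zero_comm`)
  together with the scattering equation, `∫𝒱(1 − φ)w = ∫(1 − u)𝒱φ`.
* §E the limit along solution triples `(ρ_n, e_n, u_n)` with `e_n → 0`: `ŝ_n((√e_n/π)k) → 1`
  (`seq_tendsto_s`: `|T̂(ξ) − T̂(0)| ≤ ∫min(2, 2π|y||ξ|)𝒱`), `Û_n → A − √(A²−1)`
  (`seq_tendsto_U`, `tendsto_root_of_quad`), dominated convergence in `k` with the majorant
  `M(k) = 3/(2|k|²(1+|k|²))` (`seq_tendsto_I`; the limit integral is the tree's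
  `BoseGas.integral_bogoliubov` at `μ = 1`, `∫g₁ = −32√2π/15`, `integral_g₁`), and dominated
  convergence in `x` (`seq_tendsto_Q`): `(e_n − 2πρ_na)/e_n^{3/2} → (16√2/(15π²))·4πa`.
* §F `lowDensity_of_measurable` (the `o(√ρ)` statement, uniformly over solution triples, from
  `seq_tendsto_Q` by contradiction along violating triples; the bookkeeping
  `(16√2/(15π²))·4πa·(2πρa)^{3/2} = 2πρa·(128/(15√π))√(ρa³)` is `lhy_bookkeeping`) and the assembly
  `CarlenJauslinLieb2020_thm2_holds` (an arbitrary `𝒱` is replaced by a non-negative measurable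
  modification, which changes neither the solution set nor `φ`, `a`).

## Deviations from the printed argument (recorded, not hidden)

1. Root selection and the majorant. CJL write `ρû = A − √(A² − S)` and bound the integrand by its
   value at `S = 1` through the claim that `s ↦ |A − √(A² − s) − s/(2(A−1))|` is monotone on
   `|s| ≤ 1` ((3.25)–(3.27)); that claim fails for `s < 0` (`𝒱` is not assumed radial, and even for
   radial `𝒱` `S` may be negative). Here no square root of a complex number is taken: the bound
   `|Û − ŝ/(2(A−1))| ≤ 3/(2A(A−1))` follows from `2AÛ = ŝ + Û²`, `|Û| ≤ ρ∫u = 1`, `|ŝ| ≤ 1`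
   (`quad_root_estimate`), giving the integrable majorant `M`; and the pointwise limit
   `Û_n → A − √(A² − 1)` follows from `(Û_n − r₊)(Û_n − r₋) = 1 − ŝ_n → 0` with
   `|Û_n − r₊| ≥ √(A² − 1) > 0` (`tendsto_root_of_quad`). The constant (3.28) is only needed for
   the LIMIT integrand, where it is the tree's Bogoliubov integral.
2. `ŵ` is a distribution (`w ∉ L¹`); (3.23) is made rigorous through `w_δ = Y_δ ∗ T` and `δ → 0`.
3. The appeal to (con4C) `ρ ≤ 4e/‖𝒱‖₁` after (3.29) (false in general, see
   `LiebSimpleEquationErratum.lean`) is replaced by `ρ ≤ 4e/ℓ`, `ℓ = ∫𝒱(1 − φ) > 0`, exactly as in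
   the proof of `CarlenJauslinLieb2020_thm1_holds`.
4. Two sign slips in (3.35)–(3.37) cancel; the identity proved here is
   `e_w − 2πρa = (ρ/2)∫φ𝒱(u − w)`, consistent with (3.14), and `(−Δ + 𝒱)⁻¹` is avoided altogether
   (only `G_0` and the scattering equation enter).
5. The `o(·)` statements are proved in the fact's uniform-over-solution-triples rendering by
   contradiction along sequences of triples (`e ≤ ρ∫𝒱/2`, so `ρ → 0` forces `e → 0`).

## References

* [CarlenJauslinLieb2020] E. A. Carlen, I. Jauslin, E. H. Lieb, *Analysis of a simple equation for
  the ground state energy of the Bose gas*, Pure Appl. Anal. 2 (2020) 659–684, arXiv:1912.04987: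
  Theorem 2; §3.1; §3.2: (3.7)–(3.11) and Lemma 10 (scattering solution and length), Lemma 11 with
  (3.12)–(3.38) (equation labels of the arXiv version: (u1), (ew), (eew), (ewephi), (uhat), (S),
  (uapproxw)); Theorem 1 and §2 (uniqueness, the iteration).
* [CarlenJauslinLieb2021] E. A. Carlen, I. Jauslin, E. H. Lieb, *Analysis of a simple equation for
  the ground state of the Bose gas II*, SIAM J. Math. Anal. 53 (2021) 5322–5360, arXiv:2010.13882:
  §1 (uhat) (the Fourier-transformed equation, via `LiebSimpleEquationDecayErratum.lean`).
* [LiebLoss2001] E. H. Lieb, M. Loss, *Analysis*, 2nd ed., AMS (2001), Thm. 6.23 (Yukawa and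
  Newton potentials), Thm. 5.9.
-/

noncomputable section

open MeasureTheory Filter Set Real
open scoped ENNReal NNReal Topology FourierTransform RealInnerProductSpace

namespace Literature.MathematicalPhysics.QuantumManyBody

namespace LiebSimpleEquation

open BoseGas (Space)

/-- Local notation: `𝐆[c] f = Y_c ⋆ₗ f`, the positive operator `G = (−Δ + c)⁻¹` on `[0,∞]`-valued
`f` (CJL-I (1.7)–(1.9)); `c = 0` is the Newton potential. -/
local notation3 "𝐆[" c "] " f:100 =>
  MeasureTheory.lconvolution (ENNReal.ofReal ∘ yukawa c) f MeasureTheory.volume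

/-- `𝐋[V, w] = ∫ V (1 − w)`. -/
local notation3 (prettyPrint := false) "𝐋[" V ", " w "]" => ∫⁻ z, V z * (1 - w z)

/-- The zero-energy scattering solution of an `[0,∞]`-valued potential, `φ = sup_k K_{4/(k+1)} V`
(CJL-I (3.8): `φ = lim_{e→0} K_e𝒱`; the same object as in `lowEnergy_L_ne_zero`). -/
local notation3 (prettyPrint := false) "𝛗[" V "]" =>
  fun x => ⨆ k : ℕ, kRes (4 / ((k : ℝ) + 1)) V V x

/-! ## §A. Fourier inversion almost everywhere -/

section FourierInversionAE

variable {W : Type*} [NormedAddCommGroup W] [InnerProductSpace ℝ W] [FiniteDimensional ℝ W]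
  [MeasurableSpace W] [BorelSpace W]
  {E : Type*} [NormedAddCommGroup E] [NormedSpace ℂ E] [CompleteSpace E]

/-- **Fourier inversion almost everywhere.** If `f` and `𝓕 f` are both integrable on a
finite-dimensional real inner product space, then `f = 𝓕⁻(𝓕 f)` almost everywhere (Mathlib's
`MeasureTheory.Integrable.fourierInv_fourier_eq` gives this at continuity points of `f`; here `f`
is merely integrable). Proof by duality against Schwartz test functions: for smooth compactly
supported `g = 𝓕(𝓕⁻g)`, `∫ g•f = ∫ 𝓕⁻g • 𝓕f = ∫ g • 𝓕⁻𝓕f`. [folklore] -/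
theorem ae_eq_fourierInv_fourier {f : W → E} (hf : Integrable f) (hF : Integrable (𝓕 f)) :
    f =ᵐ[volume] 𝓕⁻ (𝓕 f) := by
  have hcont : Continuous (𝓕⁻ (𝓕 f)) := by
    rw [Real.fourierInv_eq_fourier_comp_neg]
    exact VectorFourier.fourierIntegral_continuous Real.continuous_fourierChar
      (by exact continuous_inner) hF.comp_neg
  refine ae_eq_of_integral_contDiff_smul_eq hf.locallyIntegrable hcont.locallyIntegrable ?_
  intro g hg hgc
  have hg₁ : HasCompactSupport fun x ↦ (g x : ℂ) := hgc.comp_left Complex.ofReal_zero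
  have hg₂ : ContDiff ℝ ((⊤ : ℕ∞) : WithTop ℕ∞) fun x ↦ (g x : ℂ) :=
    Complex.ofRealCLM.contDiff.comp hg
  set ψ : SchwartzMap W ℂ := hg₁.toSchwartzMap hg₂ with hψ
  have hFψ : 𝓕 ((𝓕⁻ ψ : SchwartzMap W ℂ) : W → ℂ) = (ψ : W → ℂ) := by
    rw [← SchwartzMap.fourier_coe, FourierTransform.fourier_fourierInv_eq]
  -- duality, twice: `∫ ψ•f = ∫ 𝓕⁻ψ • 𝓕f` and `∫ 𝓕ψ • (𝓕f)∘neg = ∫ ψ • 𝓕((𝓕f)∘neg)`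
  have key := Literature.Analysis.Fourier.integral_fourier_smul_eq_of_integrable
    (𝓕⁻ ψ : SchwartzMap W ℂ) hf
  rw [hFψ] at key
  have key2 := Literature.Analysis.Fourier.integral_fourier_smul_eq_of_integrable ψ hF.comp_neg
  have hinv : ∀ x, (𝓕⁻ ψ : SchwartzMap W ℂ) x = 𝓕 (ψ : W → ℂ) (-x) := fun x => by
    rw [← Real.fourierInv_eq_fourier_neg, ← SchwartzMap.fourierInv_coe]
  have hflip : ∫ x, (𝓕⁻ ψ : SchwartzMap W ℂ) x • 𝓕 f x = ∫ x, 𝓕 (ψ : W → ℂ) x • 𝓕 f (-x) := by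
    have h := integral_neg_eq_self (fun x => 𝓕 (ψ : W → ℂ) x • 𝓕 f (-x)) volume
    simp only [neg_neg] at h
    rw [← h]
    exact integral_congr_ae (Eventually.of_forall fun x => by simp only [hinv x])
  have e2 : ∫ x, g x • 𝓕⁻ (𝓕 f) x = ∫ x, (ψ : W → ℂ) x • 𝓕 (fun t => 𝓕 f (-t)) x := by
    rw [← Real.fourierInv_eq_fourier_comp_neg]; rfl
  calc ∫ x, g x • f x = ∫ x, (ψ : W → ℂ) x • f x := rfl
    _ = ∫ x, (𝓕⁻ ψ : SchwartzMap W ℂ) x • 𝓕 f x := key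
    _ = ∫ x, 𝓕 (ψ : W → ℂ) x • 𝓕 f (-x) := hflip
    _ = ∫ x, (ψ : W → ℂ) x • 𝓕 (fun t => 𝓕 f (-t)) x := key2
    _ = ∫ x, g x • 𝓕⁻ (𝓕 f) x := e2.symm

end FourierInversionAE

/-! ## §B. The Newton potential and the zero-energy scattering solution -/

section Newton

variable {V : Space → ℝ≥0∞}

/-- Antitonicity of `k ↦ 4/(k+1)`. [folklore] -/
theorem four_div_succ_anti {k k' : ℕ} (h : k ≤ k') : (4 : ℝ) / ((k' : ℝ) + 1) ≤ 4 / ((k : ℝ) + 1) :=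
  div_le_div_of_nonneg_left (by norm_num) (by positivity) (by exact_mod_cast Nat.succ_le_succ h)

/-- `4/(k+1) > 0`. [folklore] -/
theorem four_div_succ_pos (k : ℕ) : (0 : ℝ) < 4 / ((k : ℝ) + 1) := by positivity

/-- `4/(k+1) → 0`. [folklore] -/
theorem tendsto_four_div_succ : Tendsto (fun k : ℕ => (4 : ℝ) / ((k : ℝ) + 1)) atTop (𝓝 0) := by
  have h := (tendsto_one_div_add_atTop_nhds_zero_nat).const_mul (4 : ℝ)
  rw [mul_zero] at h
  refine h.congr fun k => ?_
  ring

/-- **The Yukawa kernels increase to the Newton kernel**: `⨆ₖ Y_{4/(k+1)}(z) = Y_0(z)` in `[0,∞]`.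
[folklore] -/
theorem iSup_ofReal_yukawa (z : Space) :
    (⨆ k : ℕ, ENNReal.ofReal (yukawa (4 / ((k : ℝ) + 1)) z)) = ENNReal.ofReal (yukawa 0 z) := by
  have hmono : Monotone fun k : ℕ => ENNReal.ofReal (yukawa (4 / ((k : ℝ) + 1)) z) :=
    fun k k' h => ENNReal.ofReal_le_ofReal (yukawa_antitone (four_div_succ_anti h) z)
  have hcont : Continuous fun c : ℝ => yukawa c z := by unfold yukawa; fun_prop
  have htend : Tendsto (fun k : ℕ => ENNReal.ofReal (yukawa (4 / ((k : ℝ) + 1)) z)) atTop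
      (𝓝 (ENNReal.ofReal (yukawa 0 z))) :=
    ENNReal.tendsto_ofReal ((hcont.tendsto 0).comp tendsto_four_div_succ)
  exact tendsto_nhds_unique (tendsto_atTop_iSup hmono) htend

/-- **Monotone convergence of the resolvents to the Newton potential**:
`⨆ₖ G_{4/(k+1)} f = G_0 f` pointwise, for measurable `f ≥ 0`. [folklore] -/
theorem iSup_G_eq_G_zero {f : Space → ℝ≥0∞} (hf : Measurable f) (x : Space) :
    (⨆ k : ℕ, (𝐆[4 / ((k : ℝ) + 1)] f) x) = (𝐆[0] f) x := by
  simp only [lconvolution_def]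
  have hmeas : ∀ k : ℕ, Measurable fun z => (ENNReal.ofReal ∘ yukawa (4 / ((k : ℝ) + 1))) z * f (-z + x) :=
    fun k => (measurable_ofReal_yukawa _).mul (hf.comp (by fun_prop))
  have hmono : Monotone fun k : ℕ => fun z => (ENNReal.ofReal ∘ yukawa (4 / ((k : ℝ) + 1))) z * f (-z + x) :=
    fun k k' h z => mul_le_mul' (ENNReal.ofReal_le_ofReal (yukawa_antitone (four_div_succ_anti h) z)) le_rfl
  rw [← lintegral_iSup hmeas hmono]
  refine lintegral_congr fun z => ?_
  simp only [Function.comp_apply]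
  rw [← ENNReal.iSup_mul, iSup_ofReal_yukawa]

/-- **Downward monotone convergence under `G_0`**: if `K_k ↑` and `G_0 V(x) < ∞` then
`⨅ₖ G_0(V(1 − K_k))(x) = G_0(V(1 − ⨆ₖ K_k))(x)`. [folklore] -/
theorem iInf_G_zero_pot_one_sub (hV : Measurable V) (hVfin : ∀ y, V y ≠ ∞) {x : Space}
    (hG0 : (𝐆[0] V) x ≠ ∞) {K : ℕ → Space → ℝ≥0∞} (hKm : ∀ k, Measurable (K k))
    (hKmono : Monotone K) :
    (⨅ k, (𝐆[0] fun y => V y * (1 - K k y)) x) = (𝐆[0] fun y => V y * (1 - ⨆ k, K k y)) x := by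
  simp only [lconvolution_def]
  have hmeas : ∀ k, Measurable fun y => (ENNReal.ofReal ∘ yukawa 0) y * (V (-y + x) * (1 - K k (-y + x))) :=
    fun k => (measurable_ofReal_yukawa 0).mul ((measurable_L_integrand hV (hKm k)).comp (by fun_prop))
  have hanti : Antitone fun k => fun y => (ENNReal.ofReal ∘ yukawa 0) y * (V (-y + x) * (1 - K k (-y + x))) :=
    fun k k' h y => mul_le_mul' le_rfl (mul_le_mul' le_rfl (tsub_le_tsub_left (hKmono h _) _))
  have hfin : ∫⁻ y, (ENNReal.ofReal ∘ yukawa 0) y * (V (-y + x) * (1 - K 0 (-y + x))) ≠ ∞ := by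
    refine ne_top_of_le_ne_top hG0 ?_
    rw [lconvolution_def]
    exact lintegral_mono fun y => mul_le_mul' le_rfl (mul_le_of_le_one_right' tsub_le_self)
  rw [← lintegral_iInf hmeas hanti hfin]
  refine lintegral_congr fun y => ?_
  have h1 : (⨅ k, (ENNReal.ofReal ∘ yukawa 0) y * (V (-y + x) * (1 - K k (-y + x)))) =
      (ENNReal.ofReal ∘ yukawa 0) y * ⨅ k, (V (-y + x) * (1 - K k (-y + x))) :=
    (ENNReal.mul_iInf' (fun h => absurd h ENNReal.ofReal_ne_top) (fun _ => inferInstance)).symm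
  have h2 : (⨅ k, (V (-y + x) * (1 - K k (-y + x)))) = V (-y + x) * (1 - ⨆ k, K k (-y + x)) := by
    rw [ENNReal.sub_iSup ENNReal.one_ne_top]
    exact (ENNReal.mul_iInf' (fun h => absurd h (hVfin _)) (fun _ => inferInstance)).symm
  rw [h1, h2]

variable (hV : Measurable V) (hVfin : ∀ y, V y ≠ ∞)
  (hGVall : ∀ c : ℝ, 0 < c → ∃ B : ℝ≥0∞, B ≠ ∞ ∧ ∀ x, (𝐆[c] V) x ≤ B)
  (hG0 : ∀ x, (𝐆[0] V) x ≠ ∞)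
include hV hVfin hGVall

/-- `φ ≤ 1`. [cite: CarlenJauslinLieb2020, §3.2 (after (3.8))] -/
theorem scat_le_one (x : Space) : 𝛗[V] x ≤ 1 := by
  refine iSup_le fun k => ?_
  obtain ⟨B, hB, hVB⟩ := hGVall _ (four_div_succ_pos k)
  exact kRes_pot_le_one (four_div_succ_pos k) hV hVfin (fun x => ne_top_of_le_ne_top hB (hVB x)) x

omit hVfin hGVall in
/-- `φ` is measurable. [folklore] -/
theorem measurable_scat : Measurable 𝛗[V] :=
  Measurable.iSup fun _ => measurable_kRes hV hV

omit hV hVfin hGVall in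
/-- The approximants `K_{4/(k+1)}V` increase with `k`. [cite: CarlenJauslinLieb2020, §3.2 (3.8)] -/
theorem kRes_seq_monotone : Monotone fun k : ℕ => kRes (4 / ((k : ℝ) + 1)) V V :=
  fun _ _ h => kRes_anti_c (four_div_succ_anti h) V V

include hG0 in
/-- **The scattering equation in mild form**: `φ = G_0(V(1 − φ))` pointwise (CJL-I, proof of
Lemma 10: "`φ = G(𝒱(1 − φ))`, `G(x) = 1/(4π|x|)`"), obtained from `K_c V = G_c(V(1 − K_cV))`
by monotone convergence as `c = 4/(k+1) ↓ 0`. [cite: CarlenJauslinLieb2020, §3.2 (3.7)–(3.8) and Lemma 10] -/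
theorem scat_mild (x : Space) : 𝛗[V] x = (𝐆[0] fun y => V y * (1 - 𝛗[V] y)) x := by
  set K : ℕ → Space → ℝ≥0∞ := fun k => kRes (4 / ((k : ℝ) + 1)) V V with hK
  have hKm : ∀ k, Measurable (K k) := fun k => measurable_kRes hV hV
  have hKmono : Monotone K := kRes_seq_monotone
  have hmild : ∀ k y, K k y = (𝐆[4 / ((k : ℝ) + 1)] fun z => V z * (1 - K k z)) y := fun k y => by
    obtain ⟨B, hB, hVB⟩ := hGVall _ (four_div_succ_pos k)
    exact kRes_pot_mild (four_div_succ_pos k) hV hVfin hB hVB y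
  refine le_antisymm ?_ ?_
  · -- `K_k ≤ G_0(V(1 − K_m))` for `m ≥ k`, and the right side decreases to `G_0(V(1 − φ))`
    change (⨆ k, K k x) ≤ (𝐆[0] fun y => V y * (1 - ⨆ k, K k y)) x
    rw [← iInf_G_zero_pot_one_sub hV hVfin (hG0 x) hKm hKmono]
    refine iSup_le fun k => le_iInf fun m => ?_
    calc K k x ≤ K (max k m) x := hKmono (le_max_left k m) x
      _ = (𝐆[4 / (((max k m : ℕ) : ℝ) + 1)] fun z => V z * (1 - K (max k m) z)) x := hmild _ x
      _ ≤ (𝐆[0] fun z => V z * (1 - K (max k m) z)) x :=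
          yukawa_lconv_anti (four_div_succ_pos _).le _ x
      _ ≤ (𝐆[0] fun z => V z * (1 - K m z)) x :=
          G_mono 0 (fun z => mul_le_mul' le_rfl (tsub_le_tsub_left (hKmono (le_max_right k m) z) _)) x
  · -- `G_c(V(1 − φ)) ≤ G_c(V(1 − K_c)) = K_c ≤ φ`, and `G_c ↑ G_0`
    change (𝐆[0] fun y => V y * (1 - ⨆ k, K k y)) x ≤ ⨆ k, K k x
    rw [← iSup_G_eq_G_zero (measurable_L_integrand hV (Measurable.iSup hKm)) x]
    refine iSup_le fun k => ?_
    calc (𝐆[4 / ((k : ℝ) + 1)] fun y => V y * (1 - ⨆ k, K k y)) x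
        ≤ (𝐆[4 / ((k : ℝ) + 1)] fun y => V y * (1 - K k y)) x :=
          G_mono _ (fun y => mul_le_mul' le_rfl (tsub_le_tsub_left (le_iSup (fun k => K k y) k) _)) x
      _ = K k x := (hmild k x).symm
      _ ≤ ⨆ k, K k x := le_iSup (fun k => K k x) k

end Newton

/-! ## §B'. The real potential: standing hypotheses, Newton bound, the scattering solution `φ` -/

/-- The data `V + 2eρ · w ⋆ w` of one iteration step (CJL-I §2 `(iteration)`). -/
local notation3 (prettyPrint := false) "𝚽[" e ", " ρ ", " V ", " w "]" =>
  fun y => V y + ENNReal.ofReal (2 * e) * ρ * MeasureTheory.lconvolution w w MeasureTheory.volume y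

/-- One step of the iteration: `u_{n+1} = K_{4e}(V + 2eρ_n u_n ⋆ u_n)`, `ρ_n = 2e/∫V(1 − u_n)`. -/
local notation3 (prettyPrint := false) "𝐍[" e ", " V ", " w "]" =>
  kRes (4 * e) V 𝚽[e, ENNReal.ofReal (2 * e) / 𝐋[V, w], V, w]

/-- The `[0,∞]`-valued version of a real potential. -/
local notation3 (prettyPrint := false) "𝐕[" 𝒱 "]" => fun y => ENNReal.ofReal (𝒱 y)

section RealPotential

variable {𝒱 : Space → ℝ}

/-- **A uniform bound on the Newton potential**: `G_0 V ≤ e·B + ∫𝒱/(4π)` whenever `G_1 V ≤ B`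
(`Y_0 ≤ e·Y_1 + 1/(4π)`, as in `newton_pot_ne_top`). [folklore] -/
theorem newton_pot_le (hVm : Measurable 𝒱) (h0 : ∀ x, 0 ≤ 𝒱 x) (h1 : Integrable 𝒱)
    {B : ℝ≥0∞} (hVB : ∀ x, (𝐆[1] 𝐕[𝒱]) x ≤ B) (x : Space) :
    (𝐆[0] 𝐕[𝒱]) x ≤ ENNReal.ofReal (Real.exp 1) * B +
      ENNReal.ofReal ((4 * π)⁻¹) * ENNReal.ofReal (∫ y, 𝒱 y) := by
  have hVmeas : Measurable 𝐕[𝒱] := hVm.ennreal_ofReal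
  have hker : ∀ y, (ENNReal.ofReal ∘ yukawa 0) y ≤
      ENNReal.ofReal (Real.exp 1) * (ENNReal.ofReal ∘ yukawa 1) y + ENNReal.ofReal ((4 * π)⁻¹) := by
    intro y
    simp only [Function.comp_apply]
    rw [← ENNReal.ofReal_mul (Real.exp_pos 1).le,
      ← ENNReal.ofReal_add (mul_nonneg (Real.exp_pos 1).le (yukawa_nonneg 1 y)) (by positivity)]
    exact ENNReal.ofReal_le_ofReal (yukawa_zero_le y)
  have hm1 : Measurable fun y => ENNReal.ofReal (Real.exp 1) * (ENNReal.ofReal ∘ yukawa 1) y * 𝐕[𝒱] (-y + x) :=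
    ((measurable_ofReal_yukawa 1).const_mul _).mul (hVmeas.comp (by fun_prop))
  have hVs : Measurable fun y => 𝐕[𝒱] (-y + x) := hVmeas.comp (by fun_prop)
  have hYV : Measurable fun y => (ENNReal.ofReal ∘ yukawa 1) y * 𝐕[𝒱] (-y + x) :=
    (measurable_ofReal_yukawa 1).mul hVs
  have hshift : ∫⁻ y, 𝐕[𝒱] (-y + x) = ∫⁻ y, 𝐕[𝒱] y := by
    have h := (Measure.measurePreserving_sub_left (volume : Measure Space) x).lintegral_comp hVmeas
    simpa only [neg_add_eq_sub] using h
  calc (𝐆[0] 𝐕[𝒱]) x = ∫⁻ y, (ENNReal.ofReal ∘ yukawa 0) y * 𝐕[𝒱] (-y + x) := by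
        rw [lconvolution_def]
    _ ≤ ∫⁻ y, (ENNReal.ofReal (Real.exp 1) * (ENNReal.ofReal ∘ yukawa 1) y * 𝐕[𝒱] (-y + x) +
          ENNReal.ofReal ((4 * π)⁻¹) * 𝐕[𝒱] (-y + x)) := by
        refine lintegral_mono fun y => ?_
        rw [← add_mul]
        exact mul_le_mul' (hker y) le_rfl
    _ = (ENNReal.ofReal (Real.exp 1) * ∫⁻ y, ((ENNReal.ofReal ∘ yukawa 1) y * 𝐕[𝒱] (-y + x))) +
          ENNReal.ofReal ((4 * π)⁻¹) * ∫⁻ y, 𝐕[𝒱] y := by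
        rw [lintegral_add_left hm1, lintegral_const_mul _ hVs, hshift, ← lintegral_const_mul _ hYV]
        simp only [mul_assoc]
    _ ≤ ENNReal.ofReal (Real.exp 1) * B + ENNReal.ofReal ((4 * π)⁻¹) * ENNReal.ofReal (∫ y, 𝒱 y) := by
        rw [lintegral_ofReal_pot h0 h1]
        refine add_le_add (mul_le_mul' le_rfl ?_) le_rfl
        have := hVB x
        rwa [lconvolution_def] at this

variable (hVm : Measurable 𝒱) (h0 : ∀ x, 0 ≤ 𝒱 x) (h1 : Integrable 𝒱) (h2 : MemLp 𝒱 2)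
  (hpos : 0 < ∫ x, 𝒱 x)
include hVm h0 h1 h2 hpos

omit hVm h1 hpos in
/-- `G_c V` is bounded for `c > 0` (`𝒱 ∈ L²`, `2 > 3/2`). [cite: CarlenJauslinLieb2020, §2] -/
theorem pot_GVall : ∀ c : ℝ, 0 < c → ∃ B : ℝ≥0∞, B ≠ ∞ ∧ ∀ x, (𝐆[c] 𝐕[𝒱]) x ≤ B :=
  fun _ hc => exists_G_pot_bound three_halves_lt_two h0 h2 hc

omit hpos in
/-- **The Newton potential of `𝒱` is uniformly bounded**: `G_0 V ≤ B₀ < ∞`. [folklore] -/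
theorem pot_G0_bound : ∃ B₀ : ℝ≥0∞, B₀ ≠ ∞ ∧ ∀ x, (𝐆[0] 𝐕[𝒱]) x ≤ B₀ := by
  obtain ⟨B, hB, hVB⟩ := pot_GVall h0 h2 1 one_pos
  refine ⟨ENNReal.ofReal (Real.exp 1) * B + ENNReal.ofReal ((4 * π)⁻¹) * ENNReal.ofReal (∫ y, 𝒱 y),
    ENNReal.add_ne_top.2 ⟨ENNReal.mul_ne_top ENNReal.ofReal_ne_top hB,
      ENNReal.mul_ne_top ENNReal.ofReal_ne_top ENNReal.ofReal_ne_top⟩, fun x => ?_⟩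
  exact newton_pot_le hVm h0 h1 hVB x

omit hpos in
/-- `G_0 V(x) < ∞`. [folklore] -/
theorem pot_G0_ne_top (x : Space) : (𝐆[0] 𝐕[𝒱]) x ≠ ∞ := by
  obtain ⟨B₀, hB₀, hVB₀⟩ := pot_G0_bound hVm h0 h1 h2
  exact ne_top_of_le_ne_top hB₀ (hVB₀ x)

omit hVm h2 hpos in
/-- `∫ V < ∞`. [folklore] -/
theorem pot_lintegral_ne_top : ∫⁻ y, 𝐕[𝒱] y ≠ ∞ := by
  rw [lintegral_ofReal_pot h0 h1]; exact ENNReal.ofReal_ne_top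

/-! ### The scattering solution of the real potential -/

omit h1 hpos in
/-- `φ ≤ 1` for the real potential. [cite: CarlenJauslinLieb2020, §3.2] -/
theorem scat_pot_le_one (x : Space) : 𝛗[𝐕[𝒱]] x ≤ 1 :=
  scat_le_one hVm.ennreal_ofReal (fun _ => ENNReal.ofReal_ne_top) (pot_GVall h0 h2) x

omit h1 hpos in
/-- `φ(x) < ∞`. [folklore] -/
theorem scat_pot_ne_top (x : Space) : 𝛗[𝐕[𝒱]] x ≠ ∞ :=
  ne_top_of_le_ne_top ENNReal.one_ne_top (scat_pot_le_one hVm h0 h2 x)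

omit h1 hpos in
/-- `ofReal (φ.toReal) = φ`. [folklore] -/
theorem ofReal_toReal_scat_pot (x : Space) :
    ENNReal.ofReal ((𝛗[𝐕[𝒱]] x).toReal) = 𝛗[𝐕[𝒱]] x :=
  ENNReal.ofReal_toReal (scat_pot_ne_top hVm h0 h2 x)

omit h1 hpos in
/-- `0 ≤ φ.toReal ≤ 1`. [folklore] -/
theorem toReal_scat_pot_le_one (x : Space) : (𝛗[𝐕[𝒱]] x).toReal ≤ 1 := by
  have := ENNReal.toReal_mono ENNReal.one_ne_top (scat_pot_le_one hVm h0 h2 x)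
  rwa [ENNReal.toReal_one] at this

omit hpos in
/-- **The zero-energy scattering solution exists**: `φ := (sup_k K_{4/(k+1)}V).toReal` is a
scattering solution of `𝒱` in the sense of `IsScatteringSolution` (`0 ≤ φ ≤ 1`,
`φ = Y_0 ∗ (𝒱(1 − φ))` everywhere). [cite: CarlenJauslinLieb2020, §3.2 (3.7)–(3.8)] -/
theorem isScatteringSolution_scat :
    IsScatteringSolution 𝒱 fun x => (𝛗[𝐕[𝒱]] x).toReal := by
  have hV : Measurable 𝐕[𝒱] := hVm.ennreal_ofReal
  have hVfin : ∀ y, 𝐕[𝒱] y ≠ ∞ := fun _ => ENNReal.ofReal_ne_top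
  refine ⟨fun x => ENNReal.toReal_nonneg, toReal_scat_pot_le_one hVm h0 h2, fun x => ?_⟩
  have hf0 : ∀ y, 0 ≤ 𝒱 y * (1 - (𝛗[𝐕[𝒱]] y).toReal) := fun y =>
    mul_nonneg (h0 y) (sub_nonneg.2 (toReal_scat_pot_le_one hVm h0 h2 y))
  have hφm : Measurable fun y => (𝛗[𝐕[𝒱]] y).toReal := (measurable_scat hV).ennreal_toReal
  have hfm : Measurable fun y => 𝒱 y * (1 - (𝛗[𝐕[𝒱]] y).toReal) := hVm.mul (measurable_const.sub hφm)
  rw [conv_yukawa_eq_toReal_lconv 0 hf0 hfm.aestronglyMeasurable x]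
  have hof : (fun y => ENNReal.ofReal (𝒱 y * (1 - (𝛗[𝐕[𝒱]] y).toReal))) =
      fun y => 𝐕[𝒱] y * (1 - 𝛗[𝐕[𝒱]] y) := by
    funext y
    rw [ENNReal.ofReal_mul (h0 y), ENNReal.ofReal_sub _ ENNReal.toReal_nonneg, ENNReal.ofReal_one,
      ofReal_toReal_scat_pot hVm h0 h2 y]
  rw [hof]
  congr 1
  exact scat_mild hV hVfin (pot_GVall h0 h2) (pot_G0_ne_top hVm h0 h1 h2) x

omit h1 hpos in
/-- `∫ 𝒱(1 − φ) = (∫⁻ V(1 − φ)).toReal`. [folklore] -/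
theorem integral_pot_one_sub_scat :
    ∫ x, 𝒱 x * (1 - (𝛗[𝐕[𝒱]] x).toReal) = (𝐋[𝐕[𝒱], 𝛗[𝐕[𝒱]]]).toReal := by
  have hV : Measurable 𝐕[𝒱] := hVm.ennreal_ofReal
  have hφm : Measurable fun y => (𝛗[𝐕[𝒱]] y).toReal := (measurable_scat hV).ennreal_toReal
  rw [integral_eq_lintegral_of_nonneg_ae (ae_of_all _ fun y =>
      mul_nonneg (h0 y) (sub_nonneg.2 (toReal_scat_pot_le_one hVm h0 h2 y)))
    ((hVm.mul (measurable_const.sub hφm)).aestronglyMeasurable)]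
  congr 1
  refine lintegral_congr fun y => ?_
  rw [ENNReal.ofReal_mul (h0 y), ENNReal.ofReal_sub _ ENNReal.toReal_nonneg, ENNReal.ofReal_one,
    ofReal_toReal_scat_pot hVm h0 h2 y]

omit hVm h2 hpos in
/-- `ℓ = ∫⁻ V(1 − φ) < ∞`. [folklore] -/
theorem scat_L_ne_top : 𝐋[𝐕[𝒱], 𝛗[𝐕[𝒱]]] ≠ ∞ :=
  ne_top_of_le_ne_top (pot_lintegral_ne_top h0 h1)
    (lintegral_mono fun _ => mul_le_of_le_one_right' tsub_le_self)

/-- **`ℓ = ∫⁻ V(1 − φ) > 0`** (`lowEnergy_L_ne_zero`). [cite: CarlenJauslinLieb2020, §2] -/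
theorem scat_L_ne_zero : 𝐋[𝐕[𝒱], 𝛗[𝐕[𝒱]]] ≠ 0 :=
  lowEnergy_L_ne_zero hVm.ennreal_ofReal (fun _ => ENNReal.ofReal_ne_top)
    (lintegral_ofReal_pot_ne_zero h0 h1 hpos) (pot_GVall h0 h2) (pot_G0_ne_top hVm h0 h1 h2)

/-- `ℓ.toReal > 0`. [cite: CarlenJauslinLieb2020, §2] -/
theorem scat_L_toReal_pos : 0 < (𝐋[𝐕[𝒱], 𝛗[𝐕[𝒱]]]).toReal :=
  ENNReal.toReal_pos (scat_L_ne_zero hVm h0 h1 h2 hpos) (scat_L_ne_top h0 h1)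

omit h1 hpos in
/-- **The scattering length of `φ`**: `a = (4π)⁻¹ ∫𝒱(1 − φ) = ℓ/(4π)`.
[cite: CarlenJauslinLieb2020, Lemma 10 (3.11)] -/
theorem scatteringLengthOf_scat :
    scatteringLengthOf 𝒱 (fun x => (𝛗[𝐕[𝒱]] x).toReal) =
      (4 * Real.pi)⁻¹ * (𝐋[𝐕[𝒱], 𝛗[𝐕[𝒱]]]).toReal := by
  rw [scatteringLengthOf, integral_pot_one_sub_scat hVm h0 h2]

/-- `a > 0`. [cite: CarlenJauslinLieb2020, Lemma 10] -/
theorem scatteringLengthOf_scat_pos :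
    0 < scatteringLengthOf 𝒱 (fun x => (𝛗[𝐕[𝒱]] x).toReal) := by
  rw [scatteringLengthOf_scat hVm h0 h2]
  exact mul_pos (by positivity) (scat_L_toReal_pos hVm h0 h1 h2 hpos)

/-! ### The a priori bound `ρ ≤ 4e/ℓ` for solution triples (via uniqueness) -/

/-- **`ρ ≤ 4e/ℓ` for every solution triple** `(ρ, e, u)` with `e > 0` (replacing the false
printed bound (con4C) `ρ ≤ 4e/‖𝒱‖₁`): by uniqueness (CJL-I Lemma 7) the triple is the constructed
one, for which `ρ(e) ≤ 4e/ℓ` (`fam_rho_le`). [cite: CarlenJauslinLieb2020, §2 and Theorem 1] -/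
theorem IsSolution.rho_le_of_pos {ρ e : ℝ} {u : Space → ℝ} (hu : IsSolution 𝒱 ρ e u) (he : 0 < e) :
    ρ ≤ 4 * e / (𝐋[𝐕[𝒱], 𝛗[𝐕[𝒱]]]).toReal := by
  have hV : Measurable 𝐕[𝒱] := hVm.ennreal_ofReal
  have hVfin : ∀ y, 𝐕[𝒱] y ≠ ∞ := fun _ => ENNReal.ofReal_ne_top
  have hVint : ∫⁻ y, 𝐕[𝒱] y ≠ ∞ := pot_lintegral_ne_top h0 h1
  have hVpos : ∫⁻ y, 𝐕[𝒱] y ≠ 0 := lintegral_ofReal_pot_ne_zero h0 h1 hpos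
  have hGVall := pot_GVall (𝒱 := 𝒱) h0 h2
  -- the iteration family
  set w : ℝ → ℕ → Space → ℝ≥0∞ := fun e n =>
    Nat.rec (motive := fun _ => Space → ℝ≥0∞) 0 (fun _ w => 𝐍[e, 𝐕[𝒱], w]) n with hw
  have hw0 : ∀ e, w e 0 = 0 := fun e => rfl
  have hs : ∀ e n, w e (n + 1) = 𝐍[e, 𝐕[𝒱], w e n] := fun e n => rfl
  obtain ⟨B, hB, hVB⟩ := hGVall (4 * e) (four_mul_pos he)
  have huniq := isSolution_unique_of_iter three_halves_lt_two hVm h0 h1 h2 hpos he (hw0 e) (hs e) hu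
  have hρeq : ρ = (⨆ n, ENNReal.ofReal (2 * e) / 𝐋[𝐕[𝒱], w e n]).toReal := by
    rw [huniq.1, rho_usol he hV hVfin hVint hVpos hB hVB (hw0 e) (hs e)]
  have hle := fam_rho_le hV hVfin hVint hVpos hGVall hw0 hs he
  have hℓ0 := scat_L_ne_zero hVm h0 h1 h2 hpos
  have hfin : ENNReal.ofReal (4 * e) / 𝐋[𝐕[𝒱], 𝛗[𝐕[𝒱]]] ≠ ∞ :=
    ENNReal.div_ne_top ENNReal.ofReal_ne_top hℓ0
  rw [hρeq]
  have h := ENNReal.toReal_mono hfin hle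
  rw [ENNReal.toReal_div, ENNReal.toReal_ofReal (by positivity)] at h
  exact h

/-- **`ρ/(2e) ≤ 2/ℓ`** for a solution triple with `e > 0`. [cite: CarlenJauslinLieb2020, §2] -/
theorem IsSolution.rho_div_le {ρ e : ℝ} {u : Space → ℝ} (hu : IsSolution 𝒱 ρ e u) (he : 0 < e) :
    ρ / (2 * e) ≤ 2 / (𝐋[𝐕[𝒱], 𝛗[𝐕[𝒱]]]).toReal := by
  have h := hu.rho_le_of_pos hVm h0 h1 h2 hpos he
  have hℓ := scat_L_toReal_pos hVm h0 h1 h2 hpos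
  rw [div_le_iff₀ (by positivity)]
  calc ρ ≤ 4 * e / (𝐋[𝐕[𝒱], 𝛗[𝐕[𝒱]]]).toReal := h
    _ = 2 / (𝐋[𝐕[𝒱], 𝛗[𝐕[𝒱]]]).toReal * (2 * e) := by ring

end RealPotential

/-! ## §C. A solution triple in Fourier space (CJL-I §3.2, proof of (eew)) -/

/-- `𝓕u[u] = 𝓕(u : ℂ)`, the Fourier transform of a real function (Mathlib convention). -/
local notation3 (prettyPrint := false) "𝓕u[" u "]" => 𝓕 (fun x : Space => ((u x : ℝ) : ℂ))

/-- `𝓕T[u, 𝒱] = 𝓕((1 − u)𝒱 : ℂ)`, the Fourier transform of `T = (1 − u)𝒱` (CJL's `(2e/ρ)S`). -/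
local notation3 (prettyPrint := false) "𝓕T[" u ", " 𝒱 "]" => 𝓕 (fun x : Space => (((1 - u x) * 𝒱 x : ℝ) : ℂ))

section Majorant

/-- **The fixed majorant** `M(k) = 3/(2|k|²(1 + |k|²))` is integrable on `ℝ³` (polar coordinates:
`r²M(r) = (3/2)(1 + r²)⁻¹`). [folklore] -/
theorem integrable_majorant :
    Integrable fun k : Space => 3 / (2 * ‖k‖ ^ 2 * (1 + ‖k‖ ^ 2)) := by
  have h := (integrable_fun_norm_addHaar (volume : Measure Space)
    (f := fun r : ℝ => 3 / (2 * r ^ 2 * (1 + r ^ 2)))).2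
  rw [finrank_euclideanSpace_fin] at h
  simp only [Nat.add_one_sub_one, smul_eq_mul] at h
  refine h ?_
  have h1 : IntegrableOn (fun r : ℝ => (3 / 2 : ℝ) * (1 + r ^ 2)⁻¹) (Ioi 0) :=
    (integrable_inv_one_add_sq.const_mul _).integrableOn
  refine h1.congr_fun (fun r hr => ?_) measurableSet_Ioi
  have hr0 : (r : ℝ) ≠ 0 := (ne_of_gt (show (0 : ℝ) < r from hr))
  have h1r : (1 + r ^ 2 : ℝ) ≠ 0 := by positivity
  field_simp

/-- The scaled majorant `M(c k)` is integrable for `c ≠ 0`. [folklore] -/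
theorem integrable_majorant_smul {c : ℝ} (hc : c ≠ 0) :
    Integrable fun ξ : Space => 3 / (2 * ‖c • ξ‖ ^ 2 * (1 + ‖c • ξ‖ ^ 2)) :=
  integrable_majorant.comp_smul hc

/-- `M ≥ 0`. [folklore] -/
theorem majorant_nonneg (k : Space) : 0 ≤ 3 / (2 * ‖k‖ ^ 2 * (1 + ‖k‖ ^ 2)) := by positivity

/-- **The root estimate (replacing CJL-I (3.26)–(3.27)).** If `2AU = s + U²` with `A > 1`,
`|U| ≤ 1`, `|s| ≤ 1` (complex `U, s`), then `|U − s/(2(A−1))| ≤ 3/(2A(A−1))`: indeed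
`U = s/(2A − U)` with `|2A − U| ≥ 2A − 1 ≥ A`, and `U − s/(2(A−1)) = s(U−2)/(2(A−1)(2A−U))`.
(CJL bound the same quantity by its value at `s = 1` via a monotonicity claim that fails for
`s < 0`; any integrable majorant suffices for their dominated-convergence argument.)
[cite: CarlenJauslinLieb2020, §3.2 (3.25)–(3.28)] -/
theorem quad_root_estimate {A : ℝ} (hA : 1 < A) {U s : ℂ} (hU : ‖U‖ ≤ 1) (hs : ‖s‖ ≤ 1)
    (hq : 2 * (A : ℂ) * U = s + U ^ 2) :
    ‖U - s / (2 * ((A : ℂ) - 1))‖ ≤ 3 / (2 * A * (A - 1)) := by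
  have h2A : ‖(2 * (A : ℂ))‖ = 2 * A := by
    rw [show (2 * (A : ℂ)) = ((2 * A : ℝ) : ℂ) by push_cast; ring, Complex.norm_real,
      Real.norm_of_nonneg (by linarith)]
  have hD : 2 * A - 1 ≤ ‖2 * (A : ℂ) - U‖ := by
    have := norm_sub_norm_le (2 * (A : ℂ)) U
    rw [h2A] at this
    linarith
  have hDpos : 0 < ‖2 * (A : ℂ) - U‖ := by linarith
  have hD0 : 2 * (A : ℂ) - U ≠ 0 := norm_pos_iff.1 hDpos
  have hA1 : (A : ℂ) - 1 ≠ 0 := by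
    rw [sub_ne_zero]
    exact_mod_cast hA.ne'
  have hA1' : (2 : ℂ) * ((A : ℂ) - 1) ≠ 0 := mul_ne_zero two_ne_zero hA1
  have hUeq : U = s / (2 * (A : ℂ) - U) := by
    rw [eq_div_iff hD0]
    linear_combination hq
  have hdiff : U - s / (2 * ((A : ℂ) - 1)) =
      s * (U - 2) / ((2 * ((A : ℂ) - 1)) * (2 * (A : ℂ) - U)) := by
    nth_rewrite 1 [hUeq]
    rw [div_sub_div _ _ hD0 hA1', mul_comm (2 * (A : ℂ) - U) (2 * ((A : ℂ) - 1))]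
    congr 1
    ring
  have hnA : ‖(2 : ℂ) * ((A : ℂ) - 1)‖ = 2 * (A - 1) := by
    rw [show (2 : ℂ) * ((A : ℂ) - 1) = ((2 * (A - 1) : ℝ) : ℂ) by push_cast; ring, Complex.norm_real,
      Real.norm_of_nonneg (by linarith)]
  have hU2 : ‖U - 2‖ ≤ 3 := by
    calc ‖U - 2‖ ≤ ‖U‖ + ‖(2 : ℂ)‖ := norm_sub_le _ _
      _ ≤ 1 + 2 := by
          have : ‖(2 : ℂ)‖ = 2 := by simp
          rw [this]; linarith
      _ = 3 := by norm_num
  rw [hdiff, norm_div, norm_mul, norm_mul, hnA]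
  have hnum : ‖s‖ * ‖U - 2‖ ≤ 3 := by
    calc ‖s‖ * ‖U - 2‖ ≤ 1 * 3 := mul_le_mul hs hU2 (norm_nonneg _) zero_le_one
      _ = 3 := by norm_num
  have hden : 2 * A * (A - 1) ≤ 2 * (A - 1) * ‖2 * (A : ℂ) - U‖ := by
    have hA0 : 0 ≤ 2 * (A - 1) := by linarith
    nlinarith [mul_le_mul_of_nonneg_left hD hA0]
  exact div_le_div₀ (by norm_num) hnum (by nlinarith) hden

end Majorant

section Triple

variable {𝒱 : Space → ℝ} {ρ e : ℝ} {u : Space → ℝ}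

/-- `∫ (1 − u)𝒱 = 2e/ρ` (the energy constraint (1.2)). [cite: CarlenJauslinLieb2020, (1.2)] -/
theorem IsSolution.integral_T (hu : IsSolution 𝒱 ρ e u) (h0 : ∀ x, 0 ≤ 𝒱 x) (he : 0 < e) :
    ∫ x, (1 - u x) * 𝒱 x = 2 * e / ρ := by
  obtain ⟨hρ, -⟩ := hu.rho_pos h0 he
  have hE : e = ρ / 2 * ∫ x, (1 - u x) * 𝒱 x := hu.energy
  field_simp
  linarith

/-- `|û(ξ)| ≤ ∫u = 1/ρ` (CJL-I (1.6)). [cite: CarlenJauslinLieb2020, (1.6)] -/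
theorem IsSolution.norm_fourier_le (hu : IsSolution 𝒱 ρ e u) (h1 : Integrable 𝒱) (hρ : 0 < ρ)
    (he : 0 < e) (ξ : Space) : ‖𝓕u[u] ξ‖ ≤ 1 / ρ := by
  refine (norm_fourier_ofReal_le u ξ).trans (le_of_eq ?_)
  rw [← hu.integral_eq h1 hρ he]
  exact integral_congr_ae (Eventually.of_forall fun x => abs_of_nonneg (hu.nonneg x))

/-- `|T̂(ξ)| ≤ ∫T = 2e/ρ` (`|S| ≤ 1`, CJL-I (3.26)). [cite: CarlenJauslinLieb2020, §3.2 (3.26)] -/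
theorem IsSolution.norm_fourier_T_le (hu : IsSolution 𝒱 ρ e u) (h0 : ∀ x, 0 ≤ 𝒱 x) (he : 0 < e)
    (ξ : Space) : ‖𝓕T[u, 𝒱] ξ‖ ≤ 2 * e / ρ := by
  refine (norm_fourier_ofReal_le _ ξ).trans (le_of_eq ?_)
  rw [← hu.integral_T h0 he]
  exact integral_congr_ae (Eventually.of_forall fun x =>
    abs_of_nonneg (mul_nonneg (sub_nonneg.2 (hu.le_one x)) (h0 x)))

/-- `T̂(0) = 2e/ρ` (`S(0) = 1`, CJL-I after (3.28)). [cite: CarlenJauslinLieb2020, §3.2] -/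
theorem IsSolution.fourier_T_zero (hu : IsSolution 𝒱 ρ e u) (h0 : ∀ x, 0 ≤ 𝒱 x) (he : 0 < e) :
    𝓕T[u, 𝒱] 0 = ((2 * e / ρ : ℝ) : ℂ) := by
  rw [fourier_ofReal_zero, hu.integral_T h0 he]

/-- **The quadratic relation in Fourier space, normalised**: with `Û = ρû`, `ŝ = (ρ/2e)T̂`,
`A = 1 + π²|ξ|²/e`, `2AÛ = ŝ + Û²` (CJL-I (3.20)–(3.22) in Mathlib's convention `k = 2πξ`,
`k̃² = π²|ξ|²/e`). [cite: CarlenJauslinLieb2020, §3.2 (3.20)–(3.22)] -/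
theorem IsSolution.quad_relation (hu : IsSolution 𝒱 ρ e u) (h1 : Integrable 𝒱) (he : 0 < e)
    (ξ : Space) :
    2 * ((1 + Real.pi ^ 2 * ‖ξ‖ ^ 2 / e : ℝ) : ℂ) * ((ρ : ℂ) * 𝓕u[u] ξ) =
      ((ρ / (2 * e) : ℝ) : ℂ) * 𝓕T[u, 𝒱] ξ + ((ρ : ℂ) * 𝓕u[u] ξ) ^ 2 := by
  have h := hu.fourier_eq h1 he ξ
  have he0 : (e : ℂ) ≠ 0 := by exact_mod_cast he.ne'
  set Y := 𝓕u[u] ξ with hY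
  set Tf := 𝓕T[u, 𝒱] ξ with hTf
  push_cast at h ⊢
  field_simp
  linear_combination (ρ : ℂ) * h

/-- **`F = û − T̂/(4π²|ξ|²) = (1/ρ)(Û − ŝ/(2(A−1)))`** off the origin (`A − 1 = π²|ξ|²/e`; this
is `û − ŵ` with the distributional `ŵ = T̂/(4π²|ξ|²)` of `w = G_0T`, CJL-I (3.23)).
[cite: CarlenJauslinLieb2020, §3.2 (3.22)–(3.24)] -/
theorem IsSolution.F_eq (hu : IsSolution 𝒱 ρ e u) (h0 : ∀ x, 0 ≤ 𝒱 x) (he : 0 < e) {ξ : Space}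
    (hξ : ξ ≠ 0) :
    𝓕u[u] ξ - 𝓕T[u, 𝒱] ξ * ((((2 * Real.pi) ^ 2 * ‖ξ‖ ^ 2)⁻¹ : ℝ) : ℂ) =
      ((1 / ρ : ℝ) : ℂ) * ((ρ : ℂ) * 𝓕u[u] ξ -
        ((ρ / (2 * e) : ℝ) : ℂ) * 𝓕T[u, 𝒱] ξ /
          (2 * (((1 + Real.pi ^ 2 * ‖ξ‖ ^ 2 / e : ℝ) : ℂ) - 1))) := by
  obtain ⟨hρ, -⟩ := hu.rho_pos h0 he
  have hρ0 : (ρ : ℂ) ≠ 0 := by exact_mod_cast hρ.ne'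
  have he0 : (e : ℂ) ≠ 0 := by exact_mod_cast he.ne'
  have hξ0 : (‖ξ‖ : ℂ) ≠ 0 := by exact_mod_cast (norm_ne_zero_iff.2 hξ)
  have hπ0 : (Real.pi : ℂ) ≠ 0 := by exact_mod_cast Real.pi_ne_zero
  push_cast
  field_simp
  ring

/-- `‖(π/√e)ξ‖² = π²|ξ|²/e = A − 1`. [folklore] -/
theorem norm_smul_pi_div_sqrt_sq {e : ℝ} (he : 0 < e) (ξ : Space) :
    ‖(Real.pi / Real.sqrt e) • ξ‖ ^ 2 = Real.pi ^ 2 * ‖ξ‖ ^ 2 / e := by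
  rw [norm_smul, mul_pow, Real.norm_of_nonneg (by positivity), div_pow, Real.sq_sqrt he.le]
  ring

/-- **The bound on `F`**: `|F(ξ)| ≤ (1/ρ)·M((π/√e)ξ)` off the origin, `M(k) = 3/(2|k|²(1+|k|²))`
(`quad_root_estimate` with `|Û| ≤ ρ∫u = 1`, `|ŝ| ≤ (ρ/2e)∫T = 1`).
[cite: CarlenJauslinLieb2020, §3.2 (3.25)–(3.28)] -/
theorem IsSolution.norm_F_le (hu : IsSolution 𝒱 ρ e u) (h0 : ∀ x, 0 ≤ 𝒱 x) (h1 : Integrable 𝒱)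
    (he : 0 < e) {ξ : Space} (hξ : ξ ≠ 0) :
    ‖𝓕u[u] ξ - 𝓕T[u, 𝒱] ξ * ((((2 * Real.pi) ^ 2 * ‖ξ‖ ^ 2)⁻¹ : ℝ) : ℂ)‖ ≤
      1 / ρ * (3 / (2 * ‖(Real.pi / Real.sqrt e) • ξ‖ ^ 2 * (1 + ‖(Real.pi / Real.sqrt e) • ξ‖ ^ 2))) := by
  obtain ⟨hρ, -⟩ := hu.rho_pos h0 he
  rw [norm_smul_pi_div_sqrt_sq he]
  set A : ℝ := 1 + Real.pi ^ 2 * ‖ξ‖ ^ 2 / e with hA_def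
  have hξn : 0 < ‖ξ‖ := norm_pos_iff.2 hξ
  have hA1 : 0 < Real.pi ^ 2 * ‖ξ‖ ^ 2 / e := by positivity
  have hA : 1 < A := by rw [hA_def]; linarith
  set U : ℂ := (ρ : ℂ) * 𝓕u[u] ξ with hU_def
  set s : ℂ := ((ρ / (2 * e) : ℝ) : ℂ) * 𝓕T[u, 𝒱] ξ with hs_def
  have hU : ‖U‖ ≤ 1 := by
    rw [hU_def, norm_mul, Complex.norm_real, Real.norm_of_nonneg hρ.le]
    calc ρ * ‖𝓕u[u] ξ‖ ≤ ρ * (1 / ρ) := mul_le_mul_of_nonneg_left (hu.norm_fourier_le h1 hρ he ξ) hρ.le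
      _ = 1 := by field_simp
  have hs : ‖s‖ ≤ 1 := by
    rw [hs_def, norm_mul, Complex.norm_real, Real.norm_of_nonneg (by positivity)]
    calc ρ / (2 * e) * ‖𝓕T[u, 𝒱] ξ‖ ≤ ρ / (2 * e) * (2 * e / ρ) :=
          mul_le_mul_of_nonneg_left (hu.norm_fourier_T_le h0 he ξ) (by positivity)
      _ = 1 := by field_simp
  have hq : 2 * (A : ℂ) * U = s + U ^ 2 := hu.quad_relation h1 he ξ
  have key := quad_root_estimate hA hU hs hq
  rw [hu.F_eq h0 he hξ, norm_mul, Complex.norm_real, Real.norm_of_nonneg (by positivity)]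
  refine mul_le_mul_of_nonneg_left ?_ (by positivity)
  calc ‖U - s / (2 * ((A : ℂ) - 1))‖ ≤ 3 / (2 * A * (A - 1)) := key
    _ = 3 / (2 * (Real.pi ^ 2 * ‖ξ‖ ^ 2 / e) * (1 + Real.pi ^ 2 * ‖ξ‖ ^ 2 / e)) := by
        rw [hA_def]; ring

/-- `û` is continuous. [folklore] -/
theorem IsSolution.continuous_fourier (hu : IsSolution 𝒱 ρ e u) : Continuous (𝓕u[u]) :=
  VectorFourier.fourierIntegral_continuous Real.continuous_fourierChar (by exact continuous_inner)
    hu.integrable.ofReal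

/-- `T̂` is continuous. [folklore] -/
theorem IsSolution.continuous_fourier_T (hu : IsSolution 𝒱 ρ e u) (h1 : Integrable 𝒱) :
    Continuous (𝓕T[u, 𝒱]) :=
  VectorFourier.fourierIntegral_continuous Real.continuous_fourierChar (by exact continuous_inner)
    (hu.integrable_one_sub_mul h1).ofReal

/-- The weight `ξ ↦ ((c + 4π²|ξ|²)⁻¹ : ℂ)` is measurable. [folklore] -/
theorem measurable_inv_weight (c : ℝ) :
    Measurable fun ξ : Space => (((c + (2 * Real.pi) ^ 2 * ‖ξ‖ ^ 2)⁻¹ : ℝ) : ℂ) :=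
  Complex.measurable_ofReal.comp
    ((by fun_prop : Measurable fun ξ : Space => c + (2 * Real.pi) ^ 2 * ‖ξ‖ ^ 2).inv)

/-- **`F` is integrable** (`|F| ≤ ρ⁻¹M((π/√e)ξ)`, `M` integrable). [cite: CarlenJauslinLieb2020, §3.2 ("û − ŵ is [integrable]")] -/
theorem IsSolution.integrable_F (hu : IsSolution 𝒱 ρ e u) (h0 : ∀ x, 0 ≤ 𝒱 x) (h1 : Integrable 𝒱)
    (he : 0 < e) :
    Integrable fun ξ : Space => 𝓕u[u] ξ - 𝓕T[u, 𝒱] ξ * ((((2 * Real.pi) ^ 2 * ‖ξ‖ ^ 2)⁻¹ : ℝ) : ℂ) := by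
  have hm3 := measurable_inv_weight 0
  simp only [zero_add] at hm3
  have hmeas : AEStronglyMeasurable (fun ξ : Space => 𝓕u[u] ξ -
      𝓕T[u, 𝒱] ξ * ((((2 * Real.pi) ^ 2 * ‖ξ‖ ^ 2)⁻¹ : ℝ) : ℂ)) volume :=
    (hu.continuous_fourier.measurable.sub ((hu.continuous_fourier_T h1).measurable.mul hm3)).aestronglyMeasurable
  have hc : Real.pi / Real.sqrt e ≠ 0 := by positivity
  refine (((integrable_majorant_smul hc).const_mul (1 / ρ)).mono' hmeas ?_)
  filter_upwards [ae_ne_zero] with ξ hξ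
  exact hu.norm_F_le h0 h1 he hξ

/-! ### The regularised potentials `w_δ = Y_δ ∗ T` and Fourier inversion for `u − w_δ` -/

/-- `w_δ = Y_δ ∗ T` is integrable for `δ > 0`. [folklore] -/
theorem IsSolution.integrable_conv_yukawa_T (hu : IsSolution 𝒱 ρ e u) (h1 : Integrable 𝒱) {δ : ℝ}
    (hδ : 0 < δ) : Integrable (conv (yukawa δ) fun y => (1 - u y) * 𝒱 y) :=
  (integrable_yukawa hδ).integrable_convolution (ContinuousLinearMap.mul ℝ ℝ)
    (hu.integrable_one_sub_mul h1)

/-- `𝓕(Y_δ ∗ T) = T̂ · (δ + 4π²|ξ|²)⁻¹` (convolution theorem and `𝓕Y_δ`). [folklore] -/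
theorem IsSolution.fourier_conv_yukawa_T (hu : IsSolution 𝒱 ρ e u) (h1 : Integrable 𝒱) {δ : ℝ}
    (hδ : 0 < δ) (ξ : Space) :
    𝓕u[conv (yukawa δ) fun y => (1 - u y) * 𝒱 y] ξ =
      𝓕T[u, 𝒱] ξ * (((δ + (2 * Real.pi) ^ 2 * ‖ξ‖ ^ 2)⁻¹ : ℝ) : ℂ) := by
  rw [ofReal_conv_eq]
  have h : 𝓕 (MeasureTheory.convolution (fun x => (yukawa δ x : ℂ))
      (fun x => (((1 - u x) * 𝒱 x : ℝ) : ℂ)) (ContinuousLinearMap.mul ℂ ℂ) volume) ξ =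
      𝓕u[yukawa δ] ξ * 𝓕T[u, 𝒱] ξ :=
    Real.fourier_mul_convolution_eq ((integrable_yukawa hδ).ofReal (𝕜 := ℂ))
      ((hu.integrable_one_sub_mul h1).ofReal (𝕜 := ℂ)) ξ
  rw [h, fourier_yukawa hδ, mul_comm]

/-- `𝓕(u − w_δ) = û − T̂(δ + 4π²|ξ|²)⁻¹ =: F_δ`. [folklore] -/
theorem IsSolution.fourier_D (hu : IsSolution 𝒱 ρ e u) (h1 : Integrable 𝒱) {δ : ℝ} (hδ : 0 < δ) :
    𝓕 (fun x : Space => ((u x - conv (yukawa δ) (fun y => (1 - u y) * 𝒱 y) x : ℝ) : ℂ)) =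
      fun ξ => 𝓕u[u] ξ - 𝓕T[u, 𝒱] ξ * (((δ + (2 * Real.pi) ^ 2 * ‖ξ‖ ^ 2)⁻¹ : ℝ) : ℂ) := by
  funext ξ
  rw [fourier_ofReal_sub hu.integrable (hu.integrable_conv_yukawa_T h1 hδ) ξ,
    hu.fourier_conv_yukawa_T h1 hδ ξ]

/-- The elementary inequality behind the uniform majorant: for `0 < δ ≤ 4` and `a > 0`,
`0 ≤ a⁻¹ − (δ + a)⁻¹ ≤ 4/(a(a + 4))`. [folklore] -/
theorem inv_sub_inv_le {a δ : ℝ} (ha : 0 < a) (hδ : 0 < δ) (hδ4 : δ ≤ 4) :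
    0 ≤ a⁻¹ - (δ + a)⁻¹ ∧ a⁻¹ - (δ + a)⁻¹ ≤ 4 / (a * (a + 4)) := by
  have hda : 0 < δ + a := by positivity
  have heq : a⁻¹ - (δ + a)⁻¹ = δ / (a * (δ + a)) := by
    field_simp
    ring
  rw [heq]
  refine ⟨by positivity, ?_⟩
  rw [div_le_div_iff₀ (by positivity) (by positivity)]
  nlinarith [mul_le_mul_of_nonneg_right hδ4 ha.le]

/-- **The uniform majorant for `F_δ − F`**, `0 < δ ≤ 4`: `|F_δ(ξ) − F(ξ)| ≤ (2e/ρ)·(1/6)M(πξ)` off the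
origin (`|T̂| ≤ 2e/ρ`, `a⁻¹ − (δ+a)⁻¹ ≤ 4/(a(a+4))`, `a = 4π²|ξ|²`). [folklore] -/
theorem IsSolution.norm_Fδ_sub_F_le (hu : IsSolution 𝒱 ρ e u) (h0 : ∀ x, 0 ≤ 𝒱 x) (he : 0 < e)
    {δ : ℝ} (hδ : 0 < δ) (hδ4 : δ ≤ 4) {ξ : Space} (hξ : ξ ≠ 0) :
    ‖(𝓕u[u] ξ - 𝓕T[u, 𝒱] ξ * (((δ + (2 * Real.pi) ^ 2 * ‖ξ‖ ^ 2)⁻¹ : ℝ) : ℂ)) -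
        (𝓕u[u] ξ - 𝓕T[u, 𝒱] ξ * ((((2 * Real.pi) ^ 2 * ‖ξ‖ ^ 2)⁻¹ : ℝ) : ℂ))‖ ≤
      2 * e / ρ * (1 / 6 * (3 / (2 * ‖Real.pi • ξ‖ ^ 2 * (1 + ‖Real.pi • ξ‖ ^ 2)))) := by
  obtain ⟨hρ, -⟩ := hu.rho_pos h0 he
  have hξn : 0 < ‖ξ‖ := norm_pos_iff.2 hξ
  set a : ℝ := (2 * Real.pi) ^ 2 * ‖ξ‖ ^ 2 with ha_def
  have ha : 0 < a := by positivity
  have hrw : (𝓕u[u] ξ - 𝓕T[u, 𝒱] ξ * (((δ + a)⁻¹ : ℝ) : ℂ)) -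
      (𝓕u[u] ξ - 𝓕T[u, 𝒱] ξ * (((a⁻¹ : ℝ)) : ℂ)) = 𝓕T[u, 𝒱] ξ * (((a⁻¹ - (δ + a)⁻¹ : ℝ)) : ℂ) := by
    push_cast
    ring
  rw [hrw, norm_mul, Complex.norm_real, Real.norm_of_nonneg (inv_sub_inv_le ha hδ hδ4).1]
  have hM : 1 / 6 * (3 / (2 * ‖Real.pi • ξ‖ ^ 2 * (1 + ‖Real.pi • ξ‖ ^ 2))) = 4 / (a * (a + 4)) := by
    rw [norm_smul, Real.norm_of_nonneg Real.pi_pos.le, ha_def]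
    field_simp
    ring
  rw [hM]
  exact mul_le_mul (hu.norm_fourier_T_le h0 he ξ) (inv_sub_inv_le ha hδ hδ4).2
    (inv_sub_inv_le ha hδ hδ4).1 (by positivity)

/-- **`F_δ` is integrable** (`0 < δ ≤ 4`). [folklore] -/
theorem IsSolution.integrable_Fδ (hu : IsSolution 𝒱 ρ e u) (h0 : ∀ x, 0 ≤ 𝒱 x) (h1 : Integrable 𝒱)
    (he : 0 < e) {δ : ℝ} (hδ : 0 < δ) (hδ4 : δ ≤ 4) :
    Integrable fun ξ : Space => 𝓕u[u] ξ - 𝓕T[u, 𝒱] ξ * (((δ + (2 * Real.pi) ^ 2 * ‖ξ‖ ^ 2)⁻¹ : ℝ) : ℂ) := by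
  have hF := hu.integrable_F h0 h1 he
  have hm0 := measurable_inv_weight 0
  simp only [zero_add] at hm0
  have hmδ : Measurable fun ξ : Space => 𝓕u[u] ξ - 𝓕T[u, 𝒱] ξ * (((δ + (2 * Real.pi) ^ 2 * ‖ξ‖ ^ 2)⁻¹ : ℝ) : ℂ) :=
    hu.continuous_fourier.measurable.sub ((hu.continuous_fourier_T h1).measurable.mul (measurable_inv_weight δ))
  have hmF : Measurable fun ξ : Space => 𝓕u[u] ξ - 𝓕T[u, 𝒱] ξ * ((((2 * Real.pi) ^ 2 * ‖ξ‖ ^ 2)⁻¹ : ℝ) : ℂ) :=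
    hu.continuous_fourier.measurable.sub ((hu.continuous_fourier_T h1).measurable.mul hm0)
  have hdiff : Integrable fun ξ : Space => (𝓕u[u] ξ - 𝓕T[u, 𝒱] ξ * (((δ + (2 * Real.pi) ^ 2 * ‖ξ‖ ^ 2)⁻¹ : ℝ) : ℂ)) -
      (𝓕u[u] ξ - 𝓕T[u, 𝒱] ξ * ((((2 * Real.pi) ^ 2 * ‖ξ‖ ^ 2)⁻¹ : ℝ) : ℂ)) := by
    refine (((integrable_majorant_smul Real.pi_ne_zero).const_mul (1 / 6)).const_mul (2 * e / ρ)).mono'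
      (hmδ.sub hmF).aestronglyMeasurable ?_
    filter_upwards [ae_ne_zero] with ξ hξ
    exact hu.norm_Fδ_sub_F_le h0 he hδ hδ4 hξ
  exact (hF.add hdiff).congr (Eventually.of_forall fun ξ => by simp only [Pi.add_apply]; ring)

/-- **Fourier inversion for `u − w_δ`**: `u − w_δ = 𝓕⁻F_δ` almost everywhere (`0 < δ ≤ 4`; both
`u − w_δ` and `F_δ` are integrable). [cite: CarlenJauslinLieb2020, §3.2 (3.23)] -/
theorem IsSolution.D_ae_eq (hu : IsSolution 𝒱 ρ e u) (h0 : ∀ x, 0 ≤ 𝒱 x) (h1 : Integrable 𝒱)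
    (he : 0 < e) {δ : ℝ} (hδ : 0 < δ) (hδ4 : δ ≤ 4) :
    (fun x : Space => ((u x - conv (yukawa δ) (fun y => (1 - u y) * 𝒱 y) x : ℝ) : ℂ)) =ᵐ[volume]
      𝓕⁻ (fun ξ : Space => 𝓕u[u] ξ - 𝓕T[u, 𝒱] ξ * (((δ + (2 * Real.pi) ^ 2 * ‖ξ‖ ^ 2)⁻¹ : ℝ) : ℂ)) := by
  have hD : Integrable (fun x => u x - conv (yukawa δ) (fun y => (1 - u y) * 𝒱 y) x) :=
    hu.integrable.sub (hu.integrable_conv_yukawa_T h1 hδ)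
  have hFD := hu.fourier_D h1 hδ
  have hint : Integrable (𝓕 (fun x : Space =>
      ((u x - conv (yukawa δ) (fun y => (1 - u y) * 𝒱 y) x : ℝ) : ℂ))) := by
    rw [hFD]; exact hu.integrable_Fδ h0 h1 he hδ hδ4
  have h := ae_eq_fourierInv_fourier hD.ofReal hint
  rw [hFD] at h
  exact h

/-! ### The limit `δ → 0`: `u − w = 𝓕⁻F` almost everywhere -/

/-- `4/(k+1) ≤ 4`. [folklore] -/
theorem four_div_succ_le (k : ℕ) : (4 : ℝ) / ((k : ℝ) + 1) ≤ 4 :=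
  div_le_self (by norm_num) (by linarith [k.cast_nonneg (α := ℝ)])

/-- **`w_δ(x) ↑ w(x)`**: `(Y_{4/(k+1)} ∗ T)(x) → (Y_0 ∗ T)(x)` for every `x` (monotone convergence;
`Y_0 ∗ T ≤ G_0V < ∞`). [folklore] -/
theorem IsSolution.tendsto_conv_yukawa_T (hu : IsSolution 𝒱 ρ e u) (hVm : Measurable 𝒱)
    (h0 : ∀ x, 0 ≤ 𝒱 x) (h1 : Integrable 𝒱) (h2 : MemLp 𝒱 2) (he : 0 < e) (x : Space) :
    Tendsto (fun k : ℕ => conv (yukawa (4 / ((k : ℝ) + 1))) (fun y => (1 - u y) * 𝒱 y) x) atTop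
      (𝓝 (conv (yukawa 0) (fun y => (1 - u y) * 𝒱 y) x)) := by
  obtain ⟨hρ, -⟩ := hu.rho_pos h0 he
  have hum : Measurable u := hu.measurable_of hVm h0 hρ.le he.le
  have hT0 : ∀ y, 0 ≤ (1 - u y) * 𝒱 y := fun y => mul_nonneg (sub_nonneg.2 (hu.le_one y)) (h0 y)
  have hTm : Measurable fun y => (1 - u y) * 𝒱 y := (measurable_const.sub hum).mul hVm
  set TE : Space → ℝ≥0∞ := fun y => ENNReal.ofReal ((1 - u y) * 𝒱 y) with hTE
  have hTEm : Measurable TE := ENNReal.measurable_ofReal.comp hTm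
  have hconv : ∀ c, conv (yukawa c) (fun y => (1 - u y) * 𝒱 y) x = ((𝐆[c] TE) x).toReal := fun c =>
    conv_yukawa_eq_toReal_lconv c hT0 hTm.aestronglyMeasurable x
  simp only [hconv]
  have hTEle : TE ≤ 𝐕[𝒱] := fun y =>
    ENNReal.ofReal_le_ofReal (mul_le_of_le_one_left (h0 y) (by linarith [hu.nonneg y]))
  have hfin : (𝐆[0] TE) x ≠ ∞ :=
    ne_top_of_le_ne_top (pot_G0_ne_top hVm h0 h1 h2 x) (G_mono 0 hTEle x)
  have hmono : Monotone fun k : ℕ => (𝐆[4 / ((k : ℝ) + 1)] TE) x := fun k k' h =>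
    yukawa_lconv_anti (four_div_succ_anti h) TE x
  have h1' : Tendsto (fun k : ℕ => (𝐆[4 / ((k : ℝ) + 1)] TE) x) atTop (𝓝 ((𝐆[0] TE) x)) := by
    rw [← iSup_G_eq_G_zero hTEm x]
    exact tendsto_atTop_iSup hmono
  exact (ENNReal.tendsto_toReal hfin).comp h1'

/-- The regularised Fourier-side functions are continuous: `ξ ↦ û(ξ) − T̂(ξ)(δ + 4π²|ξ|²)⁻¹`
for `δ > 0`. [folklore] -/
theorem IsSolution.continuous_Fδ (hu : IsSolution 𝒱 ρ e u) (h1 : Integrable 𝒱) {δ : ℝ} (hδ : 0 < δ) :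
    Continuous fun ξ : Space => 𝓕u[u] ξ - 𝓕T[u, 𝒱] ξ * (((δ + (2 * Real.pi) ^ 2 * ‖ξ‖ ^ 2)⁻¹ : ℝ) : ℂ) := by
  have hw : Continuous fun ξ : Space => (((δ + (2 * Real.pi) ^ 2 * ‖ξ‖ ^ 2)⁻¹ : ℝ) : ℂ) := by
    refine Complex.continuous_ofReal.comp (Continuous.inv₀ (by fun_prop) fun ξ => ?_)
    positivity
  exact hu.continuous_fourier.sub ((hu.continuous_fourier_T h1).mul hw)

/-- **`𝓕⁻F_δ(x) → 𝓕⁻F(x)`** for every `x` as `δ = 4/(k+1) → 0` (dominated convergence in `ξ`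
with the majorant `|F| + (2e/ρ)(1/6)M(πξ)`). [folklore] -/
theorem IsSolution.tendsto_fourierInv_Fδ (hu : IsSolution 𝒱 ρ e u) (h0 : ∀ x, 0 ≤ 𝒱 x)
    (h1 : Integrable 𝒱) (he : 0 < e) (x : Space) :
    Tendsto (fun k : ℕ => 𝓕⁻ (fun ξ : Space => 𝓕u[u] ξ -
        𝓕T[u, 𝒱] ξ * ((((4 / ((k : ℝ) + 1)) + (2 * Real.pi) ^ 2 * ‖ξ‖ ^ 2)⁻¹ : ℝ) : ℂ)) x) atTop
      (𝓝 (𝓕⁻ (fun ξ : Space => 𝓕u[u] ξ -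
        𝓕T[u, 𝒱] ξ * ((((2 * Real.pi) ^ 2 * ‖ξ‖ ^ 2)⁻¹ : ℝ) : ℂ)) x)) := by
  simp only [Real.fourierInv_eq]
  have hF := hu.integrable_F h0 h1 he
  have hchar : Continuous fun v : Space => (𝐞 ⟪v, x⟫ : ℂ) :=
    continuous_subtype_val.comp (Real.continuous_fourierChar.comp (continuous_id.inner continuous_const))
  refine tendsto_integral_of_dominated_convergence
    (fun ξ => ‖𝓕u[u] ξ - 𝓕T[u, 𝒱] ξ * ((((2 * Real.pi) ^ 2 * ‖ξ‖ ^ 2)⁻¹ : ℝ) : ℂ)‖ +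
      2 * e / ρ * (1 / 6 * (3 / (2 * ‖Real.pi • ξ‖ ^ 2 * (1 + ‖Real.pi • ξ‖ ^ 2))))) ?_ ?_ ?_ ?_
  · intro k
    refine (Continuous.aestronglyMeasurable ?_)
    have hc := hu.continuous_Fδ h1 (four_div_succ_pos k)
    simp only [Circle.smul_def]
    exact hchar.mul hc
  · exact hF.norm.add (((integrable_majorant_smul Real.pi_ne_zero).const_mul (1 / 6)).const_mul (2 * e / ρ))
  · intro k
    filter_upwards [ae_ne_zero] with ξ hξ
    rw [Circle.smul_def, smul_eq_mul, norm_mul, Circle.norm_coe, one_mul]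
    refine (norm_le_norm_add_norm_sub' _
      (𝓕u[u] ξ - 𝓕T[u, 𝒱] ξ * ((((2 * Real.pi) ^ 2 * ‖ξ‖ ^ 2)⁻¹ : ℝ) : ℂ))).trans ?_
    exact add_le_add le_rfl (hu.norm_Fδ_sub_F_le h0 he (four_div_succ_pos k) (four_div_succ_le k) hξ)
  · filter_upwards [ae_ne_zero] with ξ hξ
    simp only [Circle.smul_def, smul_eq_mul]
    refine Tendsto.const_mul _ ?_
    have ha : (2 * Real.pi) ^ 2 * ‖ξ‖ ^ 2 ≠ 0 := by
      have := norm_pos_iff.2 hξ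
      positivity
    have hlim1 : Tendsto (fun k : ℕ => 4 / ((k : ℝ) + 1) + (2 * Real.pi) ^ 2 * ‖ξ‖ ^ 2) atTop
        (𝓝 ((2 * Real.pi) ^ 2 * ‖ξ‖ ^ 2)) := by
      have h := tendsto_four_div_succ.add_const ((2 * Real.pi) ^ 2 * ‖ξ‖ ^ 2)
      rwa [zero_add] at h
    have hlim2 := (Complex.continuous_ofReal.tendsto _).comp (hlim1.inv₀ ha)
    exact tendsto_const_nhds.sub (tendsto_const_nhds.mul hlim2)

/-- **`u − w = 𝓕⁻F` almost everywhere**, `w = Y_0 ∗ T = G_0((1 − u)𝒱)`, `F = û − T̂/(4π²|ξ|²)`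
(CJL-I (3.23): "we invert the Fourier transform"; here via `u − w_δ = 𝓕⁻F_δ` a.e. and `δ → 0`).
[cite: CarlenJauslinLieb2020, §3.2 (3.23)] -/
theorem IsSolution.ae_repr (hu : IsSolution 𝒱 ρ e u) (hVm : Measurable 𝒱) (h0 : ∀ x, 0 ≤ 𝒱 x)
    (h1 : Integrable 𝒱) (h2 : MemLp 𝒱 2) (he : 0 < e) :
    ∀ᵐ x : Space, ((u x - conv (yukawa 0) (fun y => (1 - u y) * 𝒱 y) x : ℝ) : ℂ) =
      𝓕⁻ (fun ξ : Space => 𝓕u[u] ξ - 𝓕T[u, 𝒱] ξ * ((((2 * Real.pi) ^ 2 * ‖ξ‖ ^ 2)⁻¹ : ℝ) : ℂ)) x := by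
  have hae : ∀ᵐ x : Space, ∀ k : ℕ,
      ((u x - conv (yukawa (4 / ((k : ℝ) + 1))) (fun y => (1 - u y) * 𝒱 y) x : ℝ) : ℂ) =
        𝓕⁻ (fun ξ : Space => 𝓕u[u] ξ -
          𝓕T[u, 𝒱] ξ * ((((4 / ((k : ℝ) + 1)) + (2 * Real.pi) ^ 2 * ‖ξ‖ ^ 2)⁻¹ : ℝ) : ℂ)) x := by
    rw [ae_all_iff]
    intro k
    exact hu.D_ae_eq h0 h1 he (four_div_succ_pos k) (four_div_succ_le k)
  filter_upwards [hae] with x hx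
  have hL : Tendsto (fun k : ℕ =>
      ((u x - conv (yukawa (4 / ((k : ℝ) + 1))) (fun y => (1 - u y) * 𝒱 y) x : ℝ) : ℂ)) atTop
      (𝓝 ((u x - conv (yukawa 0) (fun y => (1 - u y) * 𝒱 y) x : ℝ) : ℂ)) :=
    (Complex.continuous_ofReal.tendsto _).comp
      (tendsto_const_nhds.sub (hu.tendsto_conv_yukawa_T hVm h0 h1 h2 he x))
  have hR := hu.tendsto_fourierInv_Fδ h0 h1 he x
  exact tendsto_nhds_unique (hL.congr hx) hR

/-- **Change of variables `ξ = c k`** in `ℝ³`: `∫ g(ξ) dξ = c³ ∫ g(c k) dk` (`c > 0`). [folklore] -/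
theorem integral_eq_cube_mul_integral_smul (g : Space → ℂ) {c : ℝ} (hc : 0 < c) :
    ∫ ξ, g ξ = ((c ^ 3 : ℝ) : ℂ) * ∫ k, g (c • k) := by
  have h := Measure.integral_comp_smul (volume : Measure Space) g c
  rw [finrank_euclideanSpace_fin] at h
  rw [h, abs_of_pos (by positivity : (0 : ℝ) < (c ^ 3)⁻¹), Complex.real_smul, ← mul_assoc,
    ← Complex.ofReal_mul, mul_inv_cancel₀ (pow_ne_zero 3 hc.ne'), Complex.ofReal_one, one_mul]

end Triple

/-! ## §D. The energy identity `e − 2πρa = (ρ/2)∫(1 − φ)𝒱(w − u)` (CJL-I (3.18), (3.34)–(3.37)) -/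

section Energy

variable {𝒱 : Space → ℝ} {ρ e : ℝ} {u : Space → ℝ}

/-- **Symmetry of `G_0` (Tonelli)**: `∫ f · G_0 g = ∫ g · G_0 f` for measurable `f, g ≥ 0`
(`Y_0` is even). [folklore] -/
theorem lintegral_mul_G_zero_comm {f g : Space → ℝ≥0∞} (hf : Measurable f) (hg : Measurable g) :
    ∫⁻ x, f x * (𝐆[0] g) x = ∫⁻ y, g y * (𝐆[0] f) y := by
  have hY := measurable_ofReal_yukawa 0
  -- rewrite both convolutions as `∫ Y(x - y) · (y) dy`
  have hrepr : ∀ {h : Space → ℝ≥0∞}, Measurable h → ∀ x,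
      (𝐆[0] h) x = ∫⁻ y, (ENNReal.ofReal ∘ yukawa 0) (x - y) * h y := by
    intro h hh x
    rw [lconvolution_def]
    have hm : Measurable fun z => (ENNReal.ofReal ∘ yukawa 0) z * h (-z + x) :=
      hY.mul (hh.comp (by fun_prop))
    have := ((Measure.measurePreserving_sub_left (volume : Measure Space) x).lintegral_comp hm).symm
    refine this.trans (lintegral_congr fun y => ?_)
    congr 2
    abel
  simp_rw [hrepr hg, hrepr hf]
  have hsymm : ∀ x y : Space, (ENNReal.ofReal ∘ yukawa 0) (x - y) = (ENNReal.ofReal ∘ yukawa 0) (y - x) := by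
    intro x y
    simp only [Function.comp_apply]
    rw [← yukawa_neg 0 (y - x), neg_sub]
  calc ∫⁻ x, f x * ∫⁻ y, (ENNReal.ofReal ∘ yukawa 0) (x - y) * g y
      = ∫⁻ x, ∫⁻ y, f x * ((ENNReal.ofReal ∘ yukawa 0) (x - y) * g y) := by
        refine lintegral_congr fun x => ?_
        have hm : Measurable fun y => (ENNReal.ofReal ∘ yukawa 0) (x - y) * g y :=
          (hY.comp (measurable_const.sub measurable_id)).mul hg
        rw [lintegral_const_mul _ hm]
    _ = ∫⁻ y, ∫⁻ x, f x * ((ENNReal.ofReal ∘ yukawa 0) (x - y) * g y) := by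
        refine lintegral_lintegral_swap ?_
        exact ((hf.comp measurable_fst).mul
          ((hY.comp (measurable_fst.sub measurable_snd)).mul (hg.comp measurable_snd))).aemeasurable
    _ = ∫⁻ y, g y * ∫⁻ x, (ENNReal.ofReal ∘ yukawa 0) (y - x) * f x := by
        refine lintegral_congr fun y => ?_
        have hm : Measurable fun x => (ENNReal.ofReal ∘ yukawa 0) (y - x) * f x :=
          (hY.comp (measurable_const.sub measurable_id)).mul hf
        rw [← lintegral_const_mul _ hm]
        refine lintegral_congr fun x => ?_
        rw [hsymm x y]
        ring

variable (hVm : Measurable 𝒱) (h0 : ∀ x, 0 ≤ 𝒱 x) (h1 : Integrable 𝒱) (h2 : MemLp 𝒱 2)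
  (hpos : 0 < ∫ x, 𝒱 x)
include hVm h0 h1 h2 hpos

omit hpos in
/-- **`∫ 𝒱(1 − φ)·w = ∫ (1 − u)𝒱·φ`**, `w = Y_0 ∗ ((1 − u)𝒱)` (symmetry of `G_0 = (−Δ)⁻¹` and the
scattering equation `φ = G_0(𝒱(1 − φ))`; this is the step `(−Δ + 𝒱)⁻¹𝒱 = φ`, CJL-I (3.35)–(3.37),
done with `G_0` instead of `(−Δ + 𝒱)⁻¹`). [cite: CarlenJauslinLieb2020, §3.2 (3.34)–(3.37)] -/
theorem IsSolution.integral_pot_one_sub_scat_mul_w (hu : IsSolution 𝒱 ρ e u) (he : 0 < e) :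
    ∫ x, 𝒱 x * (1 - (𝛗[𝐕[𝒱]] x).toReal) * conv (yukawa 0) (fun y => (1 - u y) * 𝒱 y) x =
      ∫ x, (1 - u x) * 𝒱 x * (𝛗[𝐕[𝒱]] x).toReal := by
  obtain ⟨hρ, -⟩ := hu.rho_pos h0 he
  have hV : Measurable 𝐕[𝒱] := hVm.ennreal_ofReal
  have hVfin : ∀ y, 𝐕[𝒱] y ≠ ∞ := fun _ => ENNReal.ofReal_ne_top
  have hum : Measurable u := hu.measurable_of hVm h0 hρ.le he.le
  have hT0 : ∀ y, 0 ≤ (1 - u y) * 𝒱 y := fun y => mul_nonneg (sub_nonneg.2 (hu.le_one y)) (h0 y)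
  have hTm : Measurable fun y => (1 - u y) * 𝒱 y := (measurable_const.sub hum).mul hVm
  set TE : Space → ℝ≥0∞ := fun y => ENNReal.ofReal ((1 - u y) * 𝒱 y) with hTE
  have hTEm : Measurable TE := ENNReal.measurable_ofReal.comp hTm
  have hφm : Measurable 𝛗[𝐕[𝒱]] := measurable_scat hV
  have hφrm : Measurable fun y => (𝛗[𝐕[𝒱]] y).toReal := hφm.ennreal_toReal
  have hφ1 := toReal_scat_pot_le_one hVm h0 h2
  have hconv : ∀ x, conv (yukawa 0) (fun y => (1 - u y) * 𝒱 y) x = ((𝐆[0] TE) x).toReal := fun x =>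
    conv_yukawa_eq_toReal_lconv 0 hT0 hTm.aestronglyMeasurable x
  have hTEle : TE ≤ 𝐕[𝒱] := fun y =>
    ENNReal.ofReal_le_ofReal (mul_le_of_le_one_left (h0 y) (by linarith [hu.nonneg y]))
  obtain ⟨B₀, hB₀, hVB₀⟩ := pot_G0_bound hVm h0 h1 h2
  have hGfin : ∀ x, (𝐆[0] TE) x ≠ ∞ := fun x =>
    ne_top_of_le_ne_top (ne_top_of_le_ne_top hB₀ (hVB₀ x)) (G_mono 0 hTEle x)
  -- the `ℝ≥0∞` identity
  have key : ∫⁻ x, 𝐕[𝒱] x * (1 - 𝛗[𝐕[𝒱]] x) * (𝐆[0] TE) x = ∫⁻ y, TE y * 𝛗[𝐕[𝒱]] y := by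
    rw [lintegral_mul_G_zero_comm (measurable_L_integrand hV hφm) hTEm]
    refine lintegral_congr fun y => ?_
    rw [← scat_mild hV hVfin (pot_GVall h0 h2) (pot_G0_ne_top hVm h0 h1 h2) y]
  -- left side as a real integral
  have hL : ∫ x, 𝒱 x * (1 - (𝛗[𝐕[𝒱]] x).toReal) * conv (yukawa 0) (fun y => (1 - u y) * 𝒱 y) x =
      (∫⁻ x, 𝐕[𝒱] x * (1 - 𝛗[𝐕[𝒱]] x) * (𝐆[0] TE) x).toReal := by
    simp_rw [hconv]
    rw [integral_eq_lintegral_of_nonneg_ae]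
    · congr 1
      refine lintegral_congr fun x => ?_
      rw [ENNReal.ofReal_mul (mul_nonneg (h0 x) (sub_nonneg.2 (hφ1 x))), ENNReal.ofReal_mul (h0 x),
        ENNReal.ofReal_sub _ ENNReal.toReal_nonneg, ENNReal.ofReal_one, ofReal_toReal_scat_pot hVm h0 h2 x,
        ENNReal.ofReal_toReal (hGfin x)]
    · exact ae_of_all _ fun x => mul_nonneg (mul_nonneg (h0 x) (sub_nonneg.2 (hφ1 x))) ENNReal.toReal_nonneg
    · exact ((hVm.mul (measurable_const.sub hφrm)).mul
        ((G_measurable 0 hTEm).ennreal_toReal)).aestronglyMeasurable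
  have hR : ∫ x, (1 - u x) * 𝒱 x * (𝛗[𝐕[𝒱]] x).toReal = (∫⁻ y, TE y * 𝛗[𝐕[𝒱]] y).toReal := by
    rw [integral_eq_lintegral_of_nonneg_ae]
    · congr 1
      refine lintegral_congr fun x => ?_
      rw [ENNReal.ofReal_mul (hT0 x), ofReal_toReal_scat_pot hVm h0 h2 x]
    · exact ae_of_all _ fun x => mul_nonneg (hT0 x) ENNReal.toReal_nonneg
    · exact (hTm.mul hφrm).aestronglyMeasurable
  rw [hL, hR, key]

omit hpos in
/-- `w = Y_0 ∗ ((1 − u)𝒱)` is bounded by the Newton bound `B₀` and measurable. [folklore] -/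
theorem IsSolution.conv_yukawa_zero_le (hu : IsSolution 𝒱 ρ e u) (he : 0 < e) :
    ∃ C : ℝ, (∀ x, 0 ≤ conv (yukawa 0) (fun y => (1 - u y) * 𝒱 y) x ∧
      conv (yukawa 0) (fun y => (1 - u y) * 𝒱 y) x ≤ C) ∧
      Measurable (conv (yukawa 0) fun y => (1 - u y) * 𝒱 y) := by
  obtain ⟨hρ, -⟩ := hu.rho_pos h0 he
  have hum : Measurable u := hu.measurable_of hVm h0 hρ.le he.le
  have hT0 : ∀ y, 0 ≤ (1 - u y) * 𝒱 y := fun y => mul_nonneg (sub_nonneg.2 (hu.le_one y)) (h0 y)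
  have hTm : Measurable fun y => (1 - u y) * 𝒱 y := (measurable_const.sub hum).mul hVm
  set TE : Space → ℝ≥0∞ := fun y => ENNReal.ofReal ((1 - u y) * 𝒱 y) with hTE
  have hTEm : Measurable TE := ENNReal.measurable_ofReal.comp hTm
  have hconv : ∀ x, conv (yukawa 0) (fun y => (1 - u y) * 𝒱 y) x = ((𝐆[0] TE) x).toReal := fun x =>
    conv_yukawa_eq_toReal_lconv 0 hT0 hTm.aestronglyMeasurable x
  have hTEle : TE ≤ 𝐕[𝒱] := fun y =>
    ENNReal.ofReal_le_ofReal (mul_le_of_le_one_left (h0 y) (by linarith [hu.nonneg y]))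
  obtain ⟨B₀, hB₀, hVB₀⟩ := pot_G0_bound hVm h0 h1 h2
  refine ⟨B₀.toReal, fun x => ⟨?_, ?_⟩, ?_⟩
  · rw [hconv x]; exact ENNReal.toReal_nonneg
  · rw [hconv x]
    exact ENNReal.toReal_mono hB₀ ((G_mono 0 hTEle x).trans (hVB₀ x))
  · rw [show (conv (yukawa 0) fun y => (1 - u y) * 𝒱 y) = fun x => ((𝐆[0] TE) x).toReal from funext hconv]
    exact (G_measurable 0 hTEm).ennreal_toReal

omit hpos in
/-- **The energy identity** (CJL-I (3.18) + (3.37), with the symmetry step done by Tonelli):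
`e − 2πρa = (ρ/2)∫(1 − φ)𝒱·(w − u)`, where `w = G_0((1 − u)𝒱)` and `a = (4π)⁻¹∫𝒱(1 − φ)`.
(`e − e_w = (ρ/2)∫(w − u)𝒱` and `e_w − 2πρa = (ρ/2)∫φ𝒱(u − w)`.)
[cite: CarlenJauslinLieb2020, §3.2 (3.12)–(3.14), (3.18), (3.34)–(3.37)] -/
theorem IsSolution.energy_sub_eq (hu : IsSolution 𝒱 ρ e u) (he : 0 < e) :
    e - 2 * Real.pi * ρ * scatteringLengthOf 𝒱 (fun x => (𝛗[𝐕[𝒱]] x).toReal) =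
      ρ / 2 * ∫ x, (1 - (𝛗[𝐕[𝒱]] x).toReal) * 𝒱 x *
        (conv (yukawa 0) (fun y => (1 - u y) * 𝒱 y) x - u x) := by
  obtain ⟨hρ, -⟩ := hu.rho_pos h0 he
  obtain ⟨C, hC, hwm⟩ := hu.conv_yukawa_zero_le hVm h0 h1 h2 he
  set w := conv (yukawa 0) (fun y => (1 - u y) * 𝒱 y) with hw_def
  set φ : Space → ℝ := fun x => (𝛗[𝐕[𝒱]] x).toReal with hφ_def
  have hφ0 : ∀ x, 0 ≤ φ x := fun x => ENNReal.toReal_nonneg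
  have hφ1 : ∀ x, φ x ≤ 1 := toReal_scat_pot_le_one hVm h0 h2
  have hφm : Measurable φ := (measurable_scat hVm.ennreal_ofReal).ennreal_toReal
  have hum : Measurable u := hu.measurable_of hVm h0 hρ.le he.le
  -- integrable pieces
  have hT : Integrable fun x => (1 - u x) * 𝒱 x := hu.integrable_one_sub_mul h1
  have hbdd : ∀ {g : Space → ℝ}, Measurable g → (∀ x, |g x| ≤ max C 1) → ∀ {f : Space → ℝ},
      Integrable f → Integrable fun x => f x * g x := by
    intro g hg hgb f hf
    exact hf.mul_bdd (c := max C 1) hg.aestronglyMeasurable (Eventually.of_forall fun x => by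
      rw [Real.norm_eq_abs]; exact hgb x)
  have hwb : ∀ x, |w x| ≤ max C 1 := fun x => by
    rw [abs_of_nonneg (hC x).1]; exact (hC x).2.trans (le_max_left _ _)
  have hφb : ∀ x, |φ x| ≤ max C 1 := fun x => by
    rw [abs_of_nonneg (hφ0 x)]; exact (hφ1 x).trans (le_max_right _ _)
  have hub : ∀ x, |u x| ≤ max C 1 := fun x => by
    rw [abs_of_nonneg (hu.nonneg x)]; exact (hu.le_one x).trans (le_max_right _ _)
  have hPφ : Integrable fun x => (1 - φ x) * 𝒱 x := by
    have : Integrable fun x => 𝒱 x * (1 - φ x) :=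
      h1.mul_bdd (c := 1) (measurable_const.sub hφm).aestronglyMeasurable
        (Eventually.of_forall fun x => by
          rw [Real.norm_eq_abs, abs_of_nonneg (sub_nonneg.2 (hφ1 x))]; linarith [hφ0 x])
    exact this.congr (Eventually.of_forall fun x => by ring)
  have hI1 : Integrable fun x => (1 - φ x) * 𝒱 x * w x := hbdd hwm hwb hPφ
  have hI2 : Integrable fun x => (1 - φ x) * 𝒱 x * u x := hbdd hum hub hPφ
  have hI3 : Integrable fun x => (1 - u x) * 𝒱 x * φ x := hbdd hφm hφb hT
  -- the symmetry identity, in the form `∫ (1-φ)𝒱 w = ∫ (1-u)𝒱 φ`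
  have hsym : ∫ x, (1 - φ x) * 𝒱 x * w x = ∫ x, (1 - u x) * 𝒱 x * φ x := by
    rw [← hu.integral_pot_one_sub_scat_mul_w hVm h0 h1 h2 he]
    exact integral_congr_ae (Eventually.of_forall fun x => by simp only [hφ_def, hw_def]; ring)
  -- assemble
  have hE : e = ρ / 2 * ∫ x, (1 - u x) * 𝒱 x := hu.energy
  rw [scatteringLengthOf_scat hVm h0 h2, ← integral_pot_one_sub_scat hVm h0 h2]
  have hsplit : ∫ x, (1 - φ x) * 𝒱 x * (w x - u x) =
      (∫ x, (1 - φ x) * 𝒱 x * w x) - ∫ x, (1 - φ x) * 𝒱 x * u x := by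
    rw [← integral_sub hI1 hI2]
    exact integral_congr_ae (Eventually.of_forall fun x => by ring)
  have h1φ : ∀ x, |1 - φ x| ≤ max C 1 := fun x => by
    rw [abs_of_nonneg (sub_nonneg.2 (hφ1 x))]; linarith [hφ0 x, le_max_right C 1]
  have hI4 : Integrable fun x => (1 - u x) * 𝒱 x * (1 - φ x) :=
    hbdd (g := fun x => 1 - φ x) (measurable_const.sub hφm) h1φ hT
  have hA : ∫ x, (1 - u x) * 𝒱 x * φ x = (∫ x, (1 - u x) * 𝒱 x) - ∫ x, (1 - u x) * 𝒱 x * (1 - φ x) := by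
    rw [← integral_sub hT hI4]
    exact integral_congr_ae (Eventually.of_forall fun x => by ring)
  have hB : ∫ x, (1 - φ x) * 𝒱 x * u x = (∫ x, 𝒱 x * (1 - φ x)) - ∫ x, (1 - u x) * 𝒱 x * (1 - φ x) := by
    have hP' : Integrable fun x => 𝒱 x * (1 - φ x) := hPφ.congr (Eventually.of_forall fun x => by ring)
    rw [← integral_sub hP' hI4]
    exact integral_congr_ae (Eventually.of_forall fun x => by ring)
  change e - 2 * Real.pi * ρ * ((4 * Real.pi)⁻¹ * ∫ x, 𝒱 x * (1 - φ x)) =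
    ρ / 2 * ∫ x, (1 - φ x) * 𝒱 x * (w x - u x)
  rw [hsplit, hsym, hA, hB, hE]
  field_simp
  ring

end Energy

/-! ## §E. The limit along solution triples with `e → 0` (CJL-I §3.2: dominated convergence) -/

/-- `𝐅[u, 𝒱] = û − T̂·(4π²|ξ|²)⁻¹`, the Fourier transform of `u − w` (off the origin). -/
local notation3 (prettyPrint := false) "𝐅[" u ", " 𝒱 "]" =>
  fun ξ : Space => 𝓕u[u] ξ - 𝓕T[u, 𝒱] ξ * ((((2 * Real.pi) ^ 2 * ‖ξ‖ ^ 2)⁻¹ : ℝ) : ℂ)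

/-- The Lee–Huang–Yang profile `g₁(k) = 1 + |k|² − √((1 + |k|²)² − 1) − 1/(2|k|²)` (the pointwise
limit of `Û − ŝ/(2|k|²)`; `∫g₁ = −32√2π/15`). -/
local notation3 (prettyPrint := false) "𝐠₁" =>
  fun k : Space => 1 + ‖k‖ ^ 2 - Real.sqrt ((1 + ‖k‖ ^ 2) ^ 2 - 1) - 1 / (2 * ‖k‖ ^ 2)

section Limits

/-- `|e^{-2πi⟨y,ξ⟩} − 1| ≤ min(2, 2π|y||ξ|)`. [folklore] -/
theorem norm_exp_neg_inner_sub_one_le (y ξ : Space) :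
    ‖Complex.exp (↑(-2 * Real.pi * ⟪y, ξ⟫) * Complex.I) - 1‖ ≤ min 2 (2 * Real.pi * (‖y‖ * ‖ξ‖)) := by
  refine le_min ?_ ?_
  · calc ‖Complex.exp (↑(-2 * Real.pi * ⟪y, ξ⟫) * Complex.I) - 1‖
        ≤ ‖Complex.exp (↑(-2 * Real.pi * ⟪y, ξ⟫) * Complex.I)‖ + ‖(1 : ℂ)‖ := norm_sub_le _ _
      _ = 2 := by rw [Complex.norm_exp_ofReal_mul_I]; norm_num
  · rw [mul_comm _ Complex.I]
    refine (Real.norm_exp_I_mul_ofReal_sub_one_le).trans ?_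
    rw [Real.norm_eq_abs, abs_mul, abs_mul, abs_neg, abs_two, abs_of_pos Real.pi_pos]
    exact mul_le_mul_of_nonneg_left (abs_real_inner_le_norm y ξ) (by positivity)

/-- **`|T̂(ξ) − T̂(0)| ≤ ∫ min(2, 2π|y||ξ|)𝒱(y)dy`** for `0 ≤ T ≤ 𝒱` integrable. [folklore] -/
theorem norm_fourier_sub_fourier_zero_le {T 𝒱 : Space → ℝ} (hT0 : ∀ y, 0 ≤ T y) (hT : Integrable T)
    (hle : ∀ y, T y ≤ 𝒱 y) (h1 : Integrable 𝒱) (ξ : Space) :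
    ‖𝓕u[T] ξ - 𝓕u[T] 0‖ ≤ ∫ y, min 2 (2 * Real.pi * (‖y‖ * ‖ξ‖)) * 𝒱 y := by
  rw [fourier_eq_integral_exp, fourier_eq_integral_exp,
    ← integral_sub (integrable_exp_mul_ofReal hT ξ) (integrable_exp_mul_ofReal hT 0)]
  have hmc : Continuous fun y : Space => min 2 (2 * Real.pi * (‖y‖ * ‖ξ‖)) := by fun_prop
  have hgi : Integrable fun y => min 2 (2 * Real.pi * (‖y‖ * ‖ξ‖)) * 𝒱 y :=
    h1.bdd_mul (c := 2) hmc.aestronglyMeasurable (Eventually.of_forall fun y => by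
      rw [Real.norm_eq_abs, abs_of_nonneg (le_min zero_le_two (by positivity))]
      exact min_le_left _ _)
  refine norm_integral_le_of_norm_le hgi (Eventually.of_forall fun y => ?_)
  simp only [inner_zero_right, mul_zero, Complex.ofReal_zero, zero_mul, Complex.exp_zero, one_mul]
  have hfac : ∀ a b : ℂ, a * b - b = (a - 1) * b := fun a b => by ring
  rw [hfac, norm_mul, Complex.norm_real, Real.norm_of_nonneg (hT0 y)]
  exact mul_le_mul (norm_exp_neg_inner_sub_one_le y ξ) (hle y) (hT0 y)
    (le_min zero_le_two (by positivity))

/-- `ξ ↦ ∫ min(2, 2π|y||ξ|)𝒱(y)dy → 0` as `ξ → 0` (dominated convergence, majorant `2𝒱`). [folklore] -/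
theorem tendsto_integral_min_mul {𝒱 : Space → ℝ} (h1 : Integrable 𝒱) :
    Tendsto (fun ξ : Space => ∫ y, min 2 (2 * Real.pi * (‖y‖ * ‖ξ‖)) * 𝒱 y) (𝓝 0) (𝓝 0) := by
  have h0 : (∫ y : Space, min 2 (2 * Real.pi * (‖y‖ * ‖(0 : Space)‖)) * 𝒱 y) = 0 := by
    simp [norm_zero, mul_zero]
  rw [← h0]
  refine tendsto_integral_filter_of_dominated_convergence (fun y => 2 * |𝒱 y|) ?_ ?_ ?_ ?_
  · refine Eventually.of_forall fun ξ => ?_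
    have hmc : Continuous fun y : Space => min 2 (2 * Real.pi * (‖y‖ * ‖ξ‖)) := by fun_prop
    exact hmc.aestronglyMeasurable.mul h1.aestronglyMeasurable
  · refine Eventually.of_forall fun ξ => Eventually.of_forall fun y => ?_
    rw [Real.norm_eq_abs, abs_mul, abs_of_nonneg (le_min zero_le_two (by positivity))]
    exact mul_le_mul_of_nonneg_right (min_le_left _ _) (abs_nonneg _)
  · exact (h1.abs.const_mul 2)
  · refine Eventually.of_forall fun y => ?_
    have hc : Continuous fun ξ : Space => min 2 (2 * Real.pi * (‖y‖ * ‖ξ‖)) * 𝒱 y := by fun_prop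
    exact hc.tendsto 0

/-- **Root selection by continuity (replacing the formula `Û = A − √(A² − ŝ)`).** If
`2AU_n = s_n + U_n²` with `A > 1`, `|U_n| ≤ 1` and `s_n → 1`, then `U_n → A − √(A² − 1)`:
`(U_n − r₊)(U_n − r₋) = 1 − s_n → 0` with `r_± = A ± √(A²−1)` and `|U_n − r₊| ≥ r₊ − 1 ≥ √(A²−1) > 0`.
[cite: CarlenJauslinLieb2020, §3.2 (3.22)] -/
theorem tendsto_root_of_quad {A : ℝ} (hA : 1 < A) {U s : ℕ → ℂ} (hU : ∀ n, ‖U n‖ ≤ 1)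
    (hq : ∀ n, 2 * (A : ℂ) * U n = s n + U n ^ 2) (hs : Tendsto s atTop (𝓝 1)) :
    Tendsto U atTop (𝓝 (((A - Real.sqrt (A ^ 2 - 1) : ℝ)) : ℂ)) := by
  set d : ℝ := Real.sqrt (A ^ 2 - 1) with hd_def
  have hA2 : 0 < A ^ 2 - 1 := by nlinarith
  have hd : 0 < d := Real.sqrt_pos.2 hA2
  have hdd : d ^ 2 = A ^ 2 - 1 := Real.sq_sqrt hA2.le
  set rp : ℝ := A + d with hrp
  set rm : ℝ := A - d with hrm
  have hsum : rp + rm = 2 * A := by rw [hrp, hrm]; ring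
  have hprod : rp * rm = 1 := by rw [hrp, hrm]; nlinarith
  have key : ∀ n, (U n - (rp : ℂ)) * (U n - (rm : ℂ)) = 1 - s n := by
    intro n
    have e1 : (rp : ℂ) + (rm : ℂ) = 2 * (A : ℂ) := by exact_mod_cast hsum
    have e2 : (rp : ℂ) * (rm : ℂ) = 1 := by exact_mod_cast hprod
    linear_combination (-(U n)) * e1 + e2 - hq n
  -- `|U_n − r₊| ≥ d`
  have hfar : ∀ n, d ≤ ‖U n - (rp : ℂ)‖ := by
    intro n
    have h := norm_sub_norm_le (rp : ℂ) (U n)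
    rw [Complex.norm_real, Real.norm_of_nonneg (by rw [hrp]; linarith), norm_sub_rev] at h
    have : rp - 1 ≤ ‖U n - (rp : ℂ)‖ := by linarith [hU n]
    rw [hrp] at this
    linarith
  -- squeeze
  rw [tendsto_iff_norm_sub_tendsto_zero]
  have hs' : Tendsto (fun n => ‖1 - s n‖ / d) atTop (𝓝 0) := by
    have h : Tendsto (fun n => ‖(1 : ℂ) - s n‖ / d) atTop (𝓝 (‖(1 : ℂ) - 1‖ / d)) :=
      ((tendsto_const_nhds (x := (1 : ℂ))).sub hs).norm.div_const d
    rw [sub_self, norm_zero, zero_div] at h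
    exact h
  refine squeeze_zero (fun n => norm_nonneg _) (fun n => ?_) hs'
  rw [le_div_iff₀ hd]
  calc ‖U n - (rm : ℂ)‖ * d ≤ ‖U n - (rm : ℂ)‖ * ‖U n - (rp : ℂ)‖ :=
        mul_le_mul_of_nonneg_left (hfar n) (norm_nonneg _)
    _ = ‖(U n - (rp : ℂ)) * (U n - (rm : ℂ))‖ := by rw [norm_mul, mul_comm]
    _ = ‖1 - s n‖ := by rw [key n]

/-- `π²|(√e/π)k|²/e = |k|²` (the substitution `ξ = (√e/π)k`, i.e. CJL's `k̃ = k/(2√e)`). [folklore] -/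
theorem pi_sq_mul_norm_smul_sq_div {e : ℝ} (he : 0 < e) (k : Space) :
    Real.pi ^ 2 * ‖(Real.sqrt e / Real.pi) • k‖ ^ 2 / e = ‖k‖ ^ 2 := by
  rw [norm_smul, mul_pow, Real.norm_of_nonneg (by positivity), div_pow, Real.sq_sqrt he.le]
  field_simp

/-- `(π/√e)·((√e/π)k) = k`. [folklore] -/
theorem smul_smul_cancel {e : ℝ} (he : 0 < e) (k : Space) :
    (Real.pi / Real.sqrt e) • ((Real.sqrt e / Real.pi) • k) = k := by
  rw [smul_smul, div_mul_div_comm, mul_comm Real.pi, div_self (by positivity), one_smul]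

/-- `(√e/π)³ = e√e/π³`. [folklore] -/
theorem sqrt_div_pi_pow_three {e : ℝ} (he : 0 < e) :
    (Real.sqrt e / Real.pi) ^ 3 = e * Real.sqrt e / Real.pi ^ 3 := by
  rw [div_pow, pow_succ, Real.sq_sqrt he.le]

/-- **`∫ g₁ = −32√2π/15`** (the tree's Bogoliubov integral `integral_bogoliubov` at `μ = 1`:
`(1 + |k|²)² − 1 = |k|⁴ + 2|k|²`). [cite: CarlenJauslinLieb2020, §3.2 (3.28)] -/
theorem integral_g₁ : ∫ k : Space, 𝐠₁ k = -(32 * Real.sqrt 2 * Real.pi / 15) := by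
  have h := BoseGas.integral_bogoliubov one_pos
  simp only [mul_one, one_pow, Real.sqrt_one] at h
  rw [← neg_eq_iff_eq_neg, ← integral_neg, ← h]
  refine integral_congr_ae (Eventually.of_forall fun k => ?_)
  simp only
  have : (1 + ‖k‖ ^ 2) ^ 2 - 1 = ‖k‖ ^ 4 + 2 * ‖k‖ ^ 2 := by ring
  rw [this]
  ring

/-- `g₁` is integrable. [folklore] -/
theorem integrable_g₁ : Integrable fun k : Space => 𝐠₁ k := by
  have h := (BoseGas.integrable_bogoliubov one_pos).neg
  simp only [mul_one, one_pow] at h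
  refine h.congr (Eventually.of_forall fun k => ?_)
  simp only [Pi.neg_apply]
  have : (1 + ‖k‖ ^ 2) ^ 2 - 1 = ‖k‖ ^ 4 + 2 * ‖k‖ ^ 2 := by ring
  rw [this]
  ring

end Limits

section Scaled

variable {𝒱 : Space → ℝ} {ρ e : ℝ} {u : Space → ℝ}

/-- `𝐅` is measurable. [folklore] -/
theorem IsSolution.measurable_F (hu : IsSolution 𝒱 ρ e u) (h1 : Integrable 𝒱) : Measurable 𝐅[u, 𝒱] := by
  have hm0 := measurable_inv_weight 0
  simp only [zero_add] at hm0
  exact hu.continuous_fourier.measurable.sub ((hu.continuous_fourier_T h1).measurable.mul hm0)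

/-- **`|G(k)| ≤ M(k)`** for `G(k) = ρF((√e/π)k)` off the origin (`norm_F_le` rescaled). [cite: CarlenJauslinLieb2020, §3.2 (3.27)] -/
theorem IsSolution.norm_G_le (hu : IsSolution 𝒱 ρ e u) (h0 : ∀ x, 0 ≤ 𝒱 x) (h1 : Integrable 𝒱)
    (he : 0 < e) {k : Space} (hk : k ≠ 0) :
    ‖(ρ : ℂ) * 𝐅[u, 𝒱] ((Real.sqrt e / Real.pi) • k)‖ ≤ 3 / (2 * ‖k‖ ^ 2 * (1 + ‖k‖ ^ 2)) := by
  obtain ⟨hρ, -⟩ := hu.rho_pos h0 he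
  have hc : (0 : ℝ) < Real.sqrt e / Real.pi := by positivity
  have hξ : (Real.sqrt e / Real.pi) • k ≠ 0 := smul_ne_zero hc.ne' hk
  have h := hu.norm_F_le h0 h1 he hξ
  rw [smul_smul_cancel he] at h
  rw [norm_mul, Complex.norm_real, Real.norm_of_nonneg hρ.le]
  calc ρ * ‖𝐅[u, 𝒱] ((Real.sqrt e / Real.pi) • k)‖ ≤ ρ * (1 / ρ * (3 / (2 * ‖k‖ ^ 2 * (1 + ‖k‖ ^ 2)))) :=
        mul_le_mul_of_nonneg_left h hρ.le
    _ = 3 / (2 * ‖k‖ ^ 2 * (1 + ‖k‖ ^ 2)) := by field_simp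

/-- **`G = Û − ŝ/(2|k|²)`** at `ξ = (√e/π)k`, `k ≠ 0`. [cite: CarlenJauslinLieb2020, §3.2 (3.24)] -/
theorem IsSolution.G_eq (hu : IsSolution 𝒱 ρ e u) (h0 : ∀ x, 0 ≤ 𝒱 x) (he : 0 < e) {k : Space}
    (hk : k ≠ 0) :
    (ρ : ℂ) * 𝐅[u, 𝒱] ((Real.sqrt e / Real.pi) • k) =
      (ρ : ℂ) * 𝓕u[u] ((Real.sqrt e / Real.pi) • k) -
        ((ρ / (2 * e) : ℝ) : ℂ) * 𝓕T[u, 𝒱] ((Real.sqrt e / Real.pi) • k) / (2 * ((‖k‖ ^ 2 : ℝ) : ℂ)) := by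
  obtain ⟨hρ, -⟩ := hu.rho_pos h0 he
  have hc : (0 : ℝ) < Real.sqrt e / Real.pi := by positivity
  have hξ : (Real.sqrt e / Real.pi) • k ≠ 0 := smul_ne_zero hc.ne' hk
  have h := hu.F_eq h0 he hξ
  simp only at h ⊢
  rw [h, pi_sq_mul_norm_smul_sq_div he]
  have hρ0 : (ρ : ℂ) ≠ 0 := by exact_mod_cast hρ.ne'
  have hk0 : ((‖k‖ ^ 2 : ℝ) : ℂ) ≠ 0 := by exact_mod_cast (pow_ne_zero 2 (norm_ne_zero_iff.2 hk))
  push_cast at hk0 ⊢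
  field_simp
  ring

/-- **The rescaled representation (CJL-I (3.24)), a.e. in `x`**:
`(ρ/(2e√e))(w − u)(x) = −(1/(2π³)) Re ∫ e^{2πi⟨(√e/π)k, x⟩} G(k) dk`.
[cite: CarlenJauslinLieb2020, §3.2 (3.24)] -/
theorem IsSolution.ae_scaled_repr (hu : IsSolution 𝒱 ρ e u) (hVm : Measurable 𝒱)
    (h0 : ∀ x, 0 ≤ 𝒱 x) (h1 : Integrable 𝒱) (h2 : MemLp 𝒱 2) (he : 0 < e) :
    ∀ᵐ x : Space, ρ / (2 * e * Real.sqrt e) * (conv (yukawa 0) (fun y => (1 - u y) * 𝒱 y) x - u x) =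
      -(1 / (2 * Real.pi ^ 3)) * (∫ k : Space, (𝐞 ⟪(Real.sqrt e / Real.pi) • k, x⟫ : ℂ) *
        ((ρ : ℂ) * 𝐅[u, 𝒱] ((Real.sqrt e / Real.pi) • k))).re := by
  obtain ⟨hρ, -⟩ := hu.rho_pos h0 he
  have hρ0 : (ρ : ℂ) ≠ 0 := by exact_mod_cast hρ.ne'
  filter_upwards [hu.ae_repr hVm h0 h1 h2 he] with x hx
  have hc : (0 : ℝ) < Real.sqrt e / Real.pi := by positivity
  rw [Real.fourierInv_eq, integral_eq_cube_mul_integral_smul _ hc] at hx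
  have hI : (∫ k : Space, 𝐞 ⟪(Real.sqrt e / Real.pi) • k, x⟫ • 𝐅[u, 𝒱] ((Real.sqrt e / Real.pi) • k)) =
      (ρ : ℂ)⁻¹ * ∫ k : Space, (𝐞 ⟪(Real.sqrt e / Real.pi) • k, x⟫ : ℂ) *
        ((ρ : ℂ) * 𝐅[u, 𝒱] ((Real.sqrt e / Real.pi) • k)) := by
    rw [← integral_const_mul]
    refine integral_congr_ae (Eventually.of_forall fun k => ?_)
    simp only [Circle.smul_def, smul_eq_mul]
    field_simp
  rw [hI, ← mul_assoc, ← Complex.ofReal_inv, ← Complex.ofReal_mul] at hx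
  have hre := congrArg Complex.re hx
  rw [Complex.ofReal_re, Complex.re_ofReal_mul] at hre
  set I := ∫ k : Space, (𝐞 ⟪(Real.sqrt e / Real.pi) • k, x⟫ : ℂ) *
    ((ρ : ℂ) * 𝐅[u, 𝒱] ((Real.sqrt e / Real.pi) • k)) with hI_def
  have hw : conv (yukawa 0) (fun y => (1 - u y) * 𝒱 y) x - u x =
      -((Real.sqrt e / Real.pi) ^ 3 * ρ⁻¹ * I.re) := by linarith
  rw [hw, sqrt_div_pi_pow_three he]
  have hse : Real.sqrt e ≠ 0 := (Real.sqrt_pos.2 he).ne'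
  field_simp

end Scaled

section Sequence

variable {𝒱 : Space → ℝ} (hVm : Measurable 𝒱) (h0 : ∀ x, 0 ≤ 𝒱 x) (h1 : Integrable 𝒱)
  (h2 : MemLp 𝒱 2) (hpos : 0 < ∫ x, 𝒱 x) {ρs es : ℕ → ℝ} {us : ℕ → Space → ℝ}
  (hsol : ∀ n, IsSolution 𝒱 (ρs n) (es n) (us n)) (hes : ∀ n, 0 < es n)
  (hlim : Tendsto es atTop (𝓝 0))
include hVm h0 h1 h2 hpos hsol hes hlim

omit hVm h1 h2 hpos hlim in
/-- `ρ_n > 0`. [cite: CarlenJauslinLieb2020, §2] -/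
theorem seq_rho_pos (n : ℕ) : 0 < ρs n := ((hsol n).rho_pos h0 (hes n)).1

omit hVm h0 h1 h2 hpos hsol hes in
/-- `c_n = √e_n/π → 0`. [folklore] -/
theorem seq_tendsto_c : Tendsto (fun n => Real.sqrt (es n) / Real.pi) atTop (𝓝 0) := by
  have h := (Real.continuous_sqrt.tendsto 0).comp hlim
  rw [Real.sqrt_zero] at h
  simpa using h.div_const Real.pi

/-- **`ŝ_n((√e_n/π)k) → 1`**: `|ŝ_n(ξ_n) − 1| ≤ (ρ_n/2e_n)|T̂_n(ξ_n) − T̂_n(0)| ≤ (2/ℓ)∫min(2,2π|y||ξ_n|)𝒱`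
with `ξ_n = (√e_n/π)k → 0` ("using the fact that `S(0) = 1`", CJL-I after (3.28); the printed appeal
to (con4C) is replaced by `ρ ≤ 4e/ℓ`). [cite: CarlenJauslinLieb2020, §3.2 (after (3.28))] -/
theorem seq_tendsto_s (k : Space) :
    Tendsto (fun n => ((ρs n / (2 * es n) : ℝ) : ℂ) * 𝓕T[us n, 𝒱] ((Real.sqrt (es n) / Real.pi) • k))
      atTop (𝓝 1) := by
  set ℓ := (𝐋[𝐕[𝒱], 𝛗[𝐕[𝒱]]]).toReal with hℓ
  have hℓ0 : 0 < ℓ := scat_L_toReal_pos hVm h0 h1 h2 hpos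
  rw [tendsto_iff_norm_sub_tendsto_zero]
  have hJ : Tendsto (fun n => 2 / ℓ * ∫ y, min 2 (2 * Real.pi * (‖y‖ * ‖(Real.sqrt (es n) / Real.pi) • k‖)) * 𝒱 y)
      atTop (𝓝 0) := by
    have hck : Tendsto (fun n => (Real.sqrt (es n) / Real.pi) • k) atTop (𝓝 0) := by
      have h := (seq_tendsto_c hlim).smul_const k
      rwa [zero_smul] at h
    have h := (tendsto_integral_min_mul h1).comp hck
    simpa using h.const_mul (2 / ℓ)
  refine squeeze_zero (fun n => norm_nonneg _) (fun n => ?_) hJ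
  have hρ := seq_rho_pos h0 hsol hes n
  have he := hes n
  have hT0 : ∀ y, 0 ≤ (1 - us n y) * 𝒱 y := fun y => mul_nonneg (sub_nonneg.2 ((hsol n).le_one y)) (h0 y)
  have hTle : ∀ y, (1 - us n y) * 𝒱 y ≤ 𝒱 y := fun y =>
    mul_le_of_le_one_left (h0 y) (by linarith [(hsol n).nonneg y])
  have hz := (hsol n).fourier_T_zero h0 he
  have hone : ((ρs n / (2 * es n) : ℝ) : ℂ) * 𝓕T[us n, 𝒱] 0 = 1 := by
    rw [hz, ← Complex.ofReal_mul]
    have : ρs n / (2 * es n) * (2 * es n / ρs n) = 1 := by field_simp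
    rw [this, Complex.ofReal_one]
  calc ‖((ρs n / (2 * es n) : ℝ) : ℂ) * 𝓕T[us n, 𝒱] ((Real.sqrt (es n) / Real.pi) • k) - 1‖
      = ‖((ρs n / (2 * es n) : ℝ) : ℂ) * (𝓕T[us n, 𝒱] ((Real.sqrt (es n) / Real.pi) • k) - 𝓕T[us n, 𝒱] 0)‖ := by
        rw [mul_sub, hone]
    _ = ρs n / (2 * es n) * ‖𝓕T[us n, 𝒱] ((Real.sqrt (es n) / Real.pi) • k) - 𝓕T[us n, 𝒱] 0‖ := by
        rw [norm_mul, Complex.norm_real, Real.norm_of_nonneg (by positivity)]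
    _ ≤ 2 / ℓ * ∫ y, min 2 (2 * Real.pi * (‖y‖ * ‖(Real.sqrt (es n) / Real.pi) • k‖)) * 𝒱 y :=
        mul_le_mul ((hsol n).rho_div_le hVm h0 h1 h2 hpos he)
          (norm_fourier_sub_fourier_zero_le hT0 ((hsol n).integrable_one_sub_mul h1) hTle h1 _)
          (norm_nonneg _) (by positivity)

/-- **`Û_n((√e_n/π)k) → A − √(A² − 1)`, `A = 1 + |k|²`** (`k ≠ 0`), by `tendsto_root_of_quad`.
[cite: CarlenJauslinLieb2020, §3.2 (3.22)] -/
theorem seq_tendsto_U {k : Space} (hk : k ≠ 0) :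
    Tendsto (fun n => (ρs n : ℂ) * 𝓕u[us n] ((Real.sqrt (es n) / Real.pi) • k)) atTop
      (𝓝 (((1 + ‖k‖ ^ 2 - Real.sqrt ((1 + ‖k‖ ^ 2) ^ 2 - 1) : ℝ)) : ℂ)) := by
  have hA : 1 < 1 + ‖k‖ ^ 2 := by
    have := norm_pos_iff.2 hk
    nlinarith
  refine tendsto_root_of_quad hA (fun n => ?_) (fun n => ?_) (seq_tendsto_s hVm h0 h1 h2 hpos hsol hes hlim k)
  · have hρ := seq_rho_pos h0 hsol hes n
    rw [norm_mul, Complex.norm_real, Real.norm_of_nonneg hρ.le]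
    calc ρs n * ‖𝓕u[us n] ((Real.sqrt (es n) / Real.pi) • k)‖ ≤ ρs n * (1 / ρs n) :=
          mul_le_mul_of_nonneg_left ((hsol n).norm_fourier_le h1 hρ (hes n) _) hρ.le
      _ = 1 := by field_simp
  · have h := (hsol n).quad_relation h1 (hes n) ((Real.sqrt (es n) / Real.pi) • k)
    rw [pi_sq_mul_norm_smul_sq_div (hes n)] at h
    exact h

/-- **`G_n(k) → g₁(k)`** (`k ≠ 0`). [cite: CarlenJauslinLieb2020, §3.2 (3.29)] -/
theorem seq_tendsto_G {k : Space} (hk : k ≠ 0) :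
    Tendsto (fun n => (ρs n : ℂ) * 𝐅[us n, 𝒱] ((Real.sqrt (es n) / Real.pi) • k)) atTop
      (𝓝 ((𝐠₁ k : ℝ) : ℂ)) := by
  have hG : ∀ n, (ρs n : ℂ) * 𝐅[us n, 𝒱] ((Real.sqrt (es n) / Real.pi) • k) =
      (ρs n : ℂ) * 𝓕u[us n] ((Real.sqrt (es n) / Real.pi) • k) -
        ((ρs n / (2 * es n) : ℝ) : ℂ) * 𝓕T[us n, 𝒱] ((Real.sqrt (es n) / Real.pi) • k) /
          (2 * ((‖k‖ ^ 2 : ℝ) : ℂ)) := fun n => (hsol n).G_eq h0 (hes n) hk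
  simp only [hG]
  have h := (seq_tendsto_U hVm h0 h1 h2 hpos hsol hes hlim hk).sub
    ((seq_tendsto_s hVm h0 h1 h2 hpos hsol hes hlim k).div_const (2 * ((‖k‖ ^ 2 : ℝ) : ℂ)))
  convert h using 2
  push_cast
  ring

omit hVm h0 h2 hpos hes hlim in
/-- The integrand `H_n(k) = e^{2πi⟨c_n k, x⟩}G_n(k)` is a.e.-strongly measurable in `k`. [folklore] -/
theorem seq_H_aestronglyMeasurable (n : ℕ) (x : Space) :
    AEStronglyMeasurable (fun k : Space => (𝐞 ⟪(Real.sqrt (es n) / Real.pi) • k, x⟫ : ℂ) *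
      ((ρs n : ℂ) * 𝐅[us n, 𝒱] ((Real.sqrt (es n) / Real.pi) • k))) volume := by
  have hsm : Continuous fun k : Space => (Real.sqrt (es n) / Real.pi) • k :=
    continuous_const_smul (Real.sqrt (es n) / Real.pi)
  have hin : Continuous fun k : Space => ⟪(Real.sqrt (es n) / Real.pi) • k, x⟫ := hsm.inner continuous_const
  have hchar : Continuous fun k : Space => (𝐞 ⟪(Real.sqrt (es n) / Real.pi) • k, x⟫ : ℂ) :=
    continuous_subtype_val.comp (Real.continuous_fourierChar.comp hin)
  have hF : Measurable 𝐅[us n, 𝒱] := (hsol n).measurable_F h1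
  have hG : Measurable fun k : Space => (ρs n : ℂ) * 𝐅[us n, 𝒱] ((Real.sqrt (es n) / Real.pi) • k) :=
    (hF.comp (measurable_id.const_smul (Real.sqrt (es n) / Real.pi))).const_mul _
  exact (hchar.measurable.mul hG).aestronglyMeasurable

omit hVm h2 hpos hlim in
/-- `|H_n(k)| ≤ M(k)` a.e. [cite: CarlenJauslinLieb2020, §3.2 (3.27)] -/
theorem seq_norm_H_le (n : ℕ) (x : Space) :
    ∀ᵐ k : Space, ‖(𝐞 ⟪(Real.sqrt (es n) / Real.pi) • k, x⟫ : ℂ) *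
      ((ρs n : ℂ) * 𝐅[us n, 𝒱] ((Real.sqrt (es n) / Real.pi) • k))‖ ≤ 3 / (2 * ‖k‖ ^ 2 * (1 + ‖k‖ ^ 2)) := by
  filter_upwards [ae_ne_zero] with k hk
  rw [norm_mul, Circle.norm_coe, one_mul]
  exact (hsol n).norm_G_le h0 h1 (hes n) hk

omit hVm h2 hpos hlim in
/-- `|I_n(x)| ≤ ∫M`. [cite: CarlenJauslinLieb2020, §3.2 (3.28)] -/
theorem seq_norm_I_le (n : ℕ) (x : Space) :
    ‖∫ k : Space, (𝐞 ⟪(Real.sqrt (es n) / Real.pi) • k, x⟫ : ℂ) *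
        ((ρs n : ℂ) * 𝐅[us n, 𝒱] ((Real.sqrt (es n) / Real.pi) • k))‖ ≤
      ∫ k : Space, 3 / (2 * ‖k‖ ^ 2 * (1 + ‖k‖ ^ 2)) :=
  norm_integral_le_of_norm_le integrable_majorant (seq_norm_H_le h0 h1 hsol hes n x)

/-- **`I_n(x) → ∫g₁ = −32√2π/15`** for every `x` (dominated convergence in `k`, majorant `M`;
CJL-I (3.29): "by dominated convergence, and using the fact that `S(0) = 1`").
[cite: CarlenJauslinLieb2020, §3.2 (3.29)] -/
theorem seq_tendsto_I (x : Space) :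
    Tendsto (fun n => ∫ k : Space, (𝐞 ⟪(Real.sqrt (es n) / Real.pi) • k, x⟫ : ℂ) *
        ((ρs n : ℂ) * 𝐅[us n, 𝒱] ((Real.sqrt (es n) / Real.pi) • k))) atTop
      (𝓝 (((∫ k : Space, 𝐠₁ k : ℝ)) : ℂ)) := by
  rw [← integral_complex_ofReal]
  refine tendsto_integral_of_dominated_convergence (fun k => 3 / (2 * ‖k‖ ^ 2 * (1 + ‖k‖ ^ 2)))
    (fun n => seq_H_aestronglyMeasurable h1 hsol n x) integrable_majorant
    (seq_norm_H_le h0 h1 hsol hes · x) ?_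
  filter_upwards [ae_ne_zero] with k hk
  have h1' : Tendsto (fun n => (𝐞 ⟪(Real.sqrt (es n) / Real.pi) • k, x⟫ : ℂ)) atTop (𝓝 1) := by
    have hsm : Continuous fun t : ℝ => t • k := continuous_id.smul continuous_const
    have hin : Continuous fun t : ℝ => ⟪t • k, x⟫ := hsm.inner continuous_const
    have hc : Continuous fun t : ℝ => (𝐞 ⟪t • k, x⟫ : ℂ) :=
      continuous_subtype_val.comp (Real.continuous_fourierChar.comp hin)
    have h := (hc.tendsto 0).comp (seq_tendsto_c hlim)
    simp only [zero_smul, inner_zero_left, AddChar.map_zero_eq_one] at h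
    exact h
  have h2' := seq_tendsto_G hVm h0 h1 h2 hpos hsol hes hlim hk
  have h := h1'.mul h2'
  rwa [one_mul] at h

/-- **The limit of the normalised energy defect along solution triples with `e → 0`**:
`(e_n − 2πρ_n a)/e_n^{3/2} → (16√2/(15π²))∫𝒱(1 − φ) = (16√2/(15π²))·4πa`, i.e. CJL-I (3.13)+(3.14):
`e − 2πρa = (16√2/(15π²))e^{3/2}∫𝒱(1 − φ) + o(e^{3/2})` (dominated convergence in `x`).
[cite: CarlenJauslinLieb2020, §3.2 (3.13)–(3.15), (3.29), (3.38)] -/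
theorem seq_tendsto_Q :
    Tendsto (fun n => (es n - 2 * Real.pi * ρs n * scatteringLengthOf 𝒱 (fun x => (𝛗[𝐕[𝒱]] x).toReal)) /
        (es n * Real.sqrt (es n))) atTop
      (𝓝 (16 * Real.sqrt 2 / (15 * Real.pi ^ 2) * (𝐋[𝐕[𝒱], 𝛗[𝐕[𝒱]]]).toReal)) := by
  set φ : Space → ℝ := fun x => (𝛗[𝐕[𝒱]] x).toReal with hφ_def
  have hφ0 : ∀ x, 0 ≤ φ x := fun x => ENNReal.toReal_nonneg
  have hφ1 : ∀ x, φ x ≤ 1 := toReal_scat_pot_le_one hVm h0 h2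
  have hφm : Measurable φ := (measurable_scat hVm.ennreal_ofReal).ennreal_toReal
  set I : ℕ → Space → ℂ := fun n x => ∫ k : Space, (𝐞 ⟪(Real.sqrt (es n) / Real.pi) • k, x⟫ : ℂ) *
    ((ρs n : ℂ) * 𝐅[us n, 𝒱] ((Real.sqrt (es n) / Real.pi) • k)) with hI_def
  set Fs : ℕ → Space → ℝ := fun n x => (1 - φ x) * 𝒱 x * (-(1 / (2 * Real.pi ^ 3)) * (I n x).re)
    with hFs_def
  set CM : ℝ := ∫ k : Space, 3 / (2 * ‖k‖ ^ 2 * (1 + ‖k‖ ^ 2)) with hCM_def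
  -- `Q_n = ∫ Fs n`
  have hQ : ∀ n, (es n - 2 * Real.pi * ρs n * scatteringLengthOf 𝒱 φ) / (es n * Real.sqrt (es n)) =
      ∫ x, Fs n x := by
    intro n
    have he := hes n
    have hse : 0 < Real.sqrt (es n) := Real.sqrt_pos.2 he
    rw [(hsol n).energy_sub_eq hVm h0 h1 h2 he]
    have hc : ρs n / 2 * (∫ x, (1 - φ x) * 𝒱 x * (conv (yukawa 0) (fun y => (1 - us n y) * 𝒱 y) x - us n x)) /
        (es n * Real.sqrt (es n)) =
        ∫ x, (1 - φ x) * 𝒱 x * (ρs n / (2 * es n * Real.sqrt (es n)) *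
          (conv (yukawa 0) (fun y => (1 - us n y) * 𝒱 y) x - us n x)) := by
      rw [show (fun x => (1 - φ x) * 𝒱 x * (ρs n / (2 * es n * Real.sqrt (es n)) *
          (conv (yukawa 0) (fun y => (1 - us n y) * 𝒱 y) x - us n x))) =
          fun x => ρs n / (2 * es n * Real.sqrt (es n)) * ((1 - φ x) * 𝒱 x *
            (conv (yukawa 0) (fun y => (1 - us n y) * 𝒱 y) x - us n x)) from funext fun x => by ring,
        integral_const_mul]
      field_simp
    rw [hc]
    refine integral_congr_ae ?_
    filter_upwards [(hsol n).ae_scaled_repr hVm h0 h1 h2 he] with x hx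
    rw [hFs_def, hI_def]
    simp only
    rw [hx]
  -- dominated convergence in `x`
  have hlimit : Tendsto (fun n => ∫ x, Fs n x) atTop
      (𝓝 (∫ x, (1 - φ x) * 𝒱 x * (-(1 / (2 * Real.pi ^ 3)) * (∫ k : Space, 𝐠₁ k)))) := by
    refine tendsto_integral_of_dominated_convergence (fun x => 𝒱 x * (1 / (2 * Real.pi ^ 3) * CM))
      ?_ ?_ ?_ ?_
    · intro n
      obtain ⟨C, -, hwm⟩ := (hsol n).conv_yukawa_zero_le hVm h0 h1 h2 (hes n)
      have hum : Measurable (us n) :=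
        (hsol n).measurable_of hVm h0 (seq_rho_pos h0 hsol hes n).le (hes n).le
      have hmeas : Measurable fun x => (1 - φ x) * 𝒱 x * (ρs n / (2 * es n * Real.sqrt (es n)) *
          (conv (yukawa 0) (fun y => (1 - us n y) * 𝒱 y) x - us n x)) :=
        ((measurable_const.sub hφm).mul hVm).mul ((hwm.sub hum).const_mul _)
      refine hmeas.aestronglyMeasurable.congr ?_
      filter_upwards [(hsol n).ae_scaled_repr hVm h0 h1 h2 (hes n)] with x hx
      rw [hFs_def, hI_def]
      simp only
      rw [hx]
    · exact h1.mul_const _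
    · intro n
      refine Eventually.of_forall fun x => ?_
      have hIle : ‖I n x‖ ≤ CM := seq_norm_I_le h0 h1 hsol hes n x
      have hre : |(I n x).re| ≤ CM := (Complex.abs_re_le_norm _).trans hIle
      rw [Real.norm_eq_abs, hFs_def]
      simp only
      rw [abs_mul, abs_mul, abs_mul, abs_of_nonneg (sub_nonneg.2 (hφ1 x)), abs_of_nonneg (h0 x), abs_neg,
        abs_of_nonneg (by positivity : (0 : ℝ) ≤ 1 / (2 * Real.pi ^ 3))]
      calc (1 - φ x) * 𝒱 x * (1 / (2 * Real.pi ^ 3) * |(I n x).re|)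
          ≤ 1 * 𝒱 x * (1 / (2 * Real.pi ^ 3) * CM) := by
            refine mul_le_mul (mul_le_mul_of_nonneg_right (by linarith [hφ0 x]) (h0 x))
              (mul_le_mul_of_nonneg_left hre (by positivity)) (by positivity) (mul_nonneg zero_le_one (h0 x))
        _ = 𝒱 x * (1 / (2 * Real.pi ^ 3) * CM) := by ring
    · refine Eventually.of_forall fun x => ?_
      have h := (Complex.continuous_re.tendsto _).comp (seq_tendsto_I hVm h0 h1 h2 hpos hsol hes hlim x)
      rw [Complex.ofReal_re] at h
      have h' : Tendsto (fun n => (I n x).re) atTop (𝓝 (∫ k : Space, 𝐠₁ k)) := h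
      exact (h'.const_mul (-(1 / (2 * Real.pi ^ 3)))).const_mul ((1 - φ x) * 𝒱 x)
  -- the value of the limit
  have hval : ∫ x, (1 - φ x) * 𝒱 x * (-(1 / (2 * Real.pi ^ 3)) * (∫ k : Space, 𝐠₁ k)) =
      16 * Real.sqrt 2 / (15 * Real.pi ^ 2) * (𝐋[𝐕[𝒱], 𝛗[𝐕[𝒱]]]).toReal := by
    rw [integral_mul_const, integral_g₁, ← integral_pot_one_sub_scat hVm h0 h2]
    rw [show (∫ x, (1 - φ x) * 𝒱 x) = ∫ x, 𝒱 x * (1 - φ x) from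
      integral_congr_ae (Eventually.of_forall fun x => by ring)]
    field_simp
    ring
  rw [← hval]
  exact hlimit.congr fun n => (hQ n).symm

end Sequence

/-! ## §F. Assembly: CJL-I Theorem 2 -/

section Assembly

variable {𝒱 : Space → ℝ}

/-- The LHY bookkeeping: `κ√(2πa) = (128/(15√π))a^{3/2}` for `κ = 64√2a/(15π)`, i.e.
`2πρa · (128/(15√π))√(ρa³) = κ (2πρa)^{3/2}` with `κ = (16√2/(15π²))·4πa`. [cite: CarlenJauslinLieb2020, §3.2 (3.15)] -/
theorem lhy_bookkeeping {a ρ : ℝ} (ha : 0 < a) (hρ : 0 < ρ) :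
    2 * Real.pi * ρ * a * (128 / (15 * Real.sqrt Real.pi) * Real.sqrt (ρ * a ^ 3)) =
      16 * Real.sqrt 2 / (15 * Real.pi ^ 2) * (4 * Real.pi * a) *
        ((2 * Real.pi * ρ * a) * Real.sqrt (2 * Real.pi * ρ * a)) := by
  have hπ := Real.pi_pos
  have hsπ : Real.sqrt Real.pi ^ 2 = Real.pi := Real.sq_sqrt hπ.le
  have hs2 : Real.sqrt 2 ^ 2 = 2 := Real.sq_sqrt zero_le_two
  have e1 : Real.sqrt (ρ * a ^ 3) = a * Real.sqrt (ρ * a) := by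
    rw [show ρ * a ^ 3 = a ^ 2 * (ρ * a) by ring, Real.sqrt_mul (by positivity), Real.sqrt_sq ha.le]
  have e2 : Real.sqrt (2 * Real.pi * ρ * a) = Real.sqrt 2 * Real.sqrt Real.pi * Real.sqrt (ρ * a) := by
    rw [show 2 * Real.pi * ρ * a = 2 * (Real.pi * (ρ * a)) by ring, Real.sqrt_mul zero_le_two,
      Real.sqrt_mul hπ.le, mul_assoc]
  rw [e1, e2]
  have hsπ0 : Real.sqrt Real.pi ≠ 0 := (Real.sqrt_pos.2 hπ).ne'
  field_simp
  nlinarith [hsπ, hs2, Real.sqrt_nonneg (ρ * a), Real.sqrt_nonneg 2, Real.sqrt_nonneg Real.pi]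

variable (hVm : Measurable 𝒱) (h0 : ∀ x, 0 ≤ 𝒱 x) (h1 : Integrable 𝒱) (h2 : MemLp 𝒱 2)
  (hpos : 0 < ∫ x, 𝒱 x)
include hVm h0 h1 h2 hpos

/-- **CJL-I Theorem 2, low-density half, for a measurable potential.** With the scattering solution
`φ = sup_k K_{4/(k+1)}𝒱` and `a = (4π)⁻¹∫𝒱(1 − φ)`: for every `ε > 0` there is `ρ₀ > 0` such that
every solution triple `(ρ, e, u)` with `ρ < ρ₀` satisfies
`|e − 2πρa(1 + (128/(15√π))√(ρa³))| ≤ ε·2πρa·√ρ`. Proof by contradiction from `seq_tendsto_Q`: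
along violating triples `e_n → 0`, `(e_n − b_n)/e_n^{3/2} → κ` (`b_n = 2πρ_na`) forces `b_n/e_n → 1`
and `|e_n − b_n − κb_n^{3/2}|/e_n^{3/2} → 0`, while the violation gives the lower bound
`ε(b_n/e_n)√(ρ_n/e_n) ≥ ε(b_n/e_n)√(2/∫𝒱)`. [cite: CarlenJauslinLieb2020, Theorem 2 and §3.2 (3.15)] -/
theorem lowDensity_of_measurable :
    ∀ ε : ℝ, 0 < ε → ∃ ρ₀ : ℝ, 0 < ρ₀ ∧
      ∀ (ρ e : ℝ) (u : Space → ℝ), 0 < ρ → ρ < ρ₀ → 0 < e → IsSolution 𝒱 ρ e u →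
        |e - 2 * Real.pi * ρ * scatteringLengthOf 𝒱 (fun x => (𝛗[𝐕[𝒱]] x).toReal) *
            (1 + 128 / (15 * Real.sqrt Real.pi) *
              Real.sqrt (ρ * scatteringLengthOf 𝒱 (fun x => (𝛗[𝐕[𝒱]] x).toReal) ^ 3))| ≤
          ε * (2 * Real.pi * ρ * scatteringLengthOf 𝒱 (fun x => (𝛗[𝐕[𝒱]] x).toReal)) * Real.sqrt ρ := by
  set a := scatteringLengthOf 𝒱 (fun x => (𝛗[𝐕[𝒱]] x).toReal) with ha_def
  have ha : 0 < a := scatteringLengthOf_scat_pos hVm h0 h1 h2 hpos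
  have haℓ : 4 * Real.pi * a = (𝐋[𝐕[𝒱], 𝛗[𝐕[𝒱]]]).toReal := by
    rw [ha_def, scatteringLengthOf_scat hVm h0 h2]; field_simp
  set κ : ℝ := 16 * Real.sqrt 2 / (15 * Real.pi ^ 2) * (4 * Real.pi * a) with hκ_def
  have hκ0 : 0 ≤ κ := by positivity
  intro ε hε
  by_contra hcon
  push Not at hcon
  choose ρs es us hρs hρlt hes hsol hviol using fun n : ℕ => hcon (1 / ((n : ℝ) + 1)) (by positivity)
  -- `e_n → 0`
  have hIV : 0 < ∫ x, 𝒱 x := hpos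
  have hes0 : Tendsto es atTop (𝓝 0) := by
    have hup : ∀ n, es n ≤ (∫ x, 𝒱 x) / 2 * (1 / ((n : ℝ) + 1)) := fun n => by
      have h := (hsol n).two_mul_le h0 h1 (hρs n).le
      nlinarith [hρlt n]
    have hT : Tendsto (fun n : ℕ => (∫ x, 𝒱 x) / 2 * (1 / ((n : ℝ) + 1))) atTop (𝓝 0) := by
      have h := (tendsto_one_div_add_atTop_nhds_zero_nat).const_mul ((∫ x, 𝒱 x) / 2)
      rwa [mul_zero] at h
    exact squeeze_zero (fun n => (hes n).le) hup hT
  have hQ := seq_tendsto_Q hVm h0 h1 h2 hpos hsol hes hes0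
  rw [← haℓ] at hQ
  -- notation: `b_n = 2πρ_n a`, `t_n = b_n/e_n`, `Q_n`
  set b : ℕ → ℝ := fun n => 2 * Real.pi * ρs n * a with hb_def
  set Q : ℕ → ℝ := fun n => (es n - b n) / (es n * Real.sqrt (es n)) with hQ_def
  set t : ℕ → ℝ := fun n => b n / es n with ht_def
  have hb0 : ∀ n, 0 < b n := fun n => by rw [hb_def]; simp only; have := hρs n; positivity
  have hQ' : Tendsto Q atTop (𝓝 κ) := hQ
  -- `t_n → 1`: `t_n = 1 − Q_n √e_n`
  have ht : Tendsto t atTop (𝓝 1) := by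
    have hsq : Tendsto (fun n => Real.sqrt (es n)) atTop (𝓝 0) := by
      have h := (Real.continuous_sqrt.tendsto 0).comp hes0
      rwa [Real.sqrt_zero] at h
    have h := (tendsto_const_nhds (x := (1 : ℝ))).sub (hQ'.mul hsq)
    rw [mul_zero, sub_zero] at h
    refine h.congr fun n => ?_
    have he := hes n
    rw [ht_def, hQ_def]
    simp only
    set r := Real.sqrt (es n) with hr_def
    have hr0 : r ≠ 0 := (Real.sqrt_pos.2 he).ne'
    have hr2 : es n = r ^ 2 := (Real.sq_sqrt he.le).symm
    rw [hr2]
    field_simp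
    ring
  -- the upper bound `X_n → 0`
  set X : ℕ → ℝ := fun n => |Q n - κ| + κ * |1 - t n * Real.sqrt (t n)| with hX_def
  have hX : Tendsto X atTop (𝓝 0) := by
    have hA : Tendsto (fun n => |Q n - κ|) atTop (𝓝 0) := by
      have h := (hQ'.sub (tendsto_const_nhds (x := κ))).abs
      rwa [sub_self, abs_zero] at h
    have hB : Tendsto (fun n => κ * |1 - t n * Real.sqrt (t n)|) atTop (𝓝 0) := by
      have hc : Continuous fun s : ℝ => κ * |1 - s * Real.sqrt s| := by fun_prop
      have h := (hc.tendsto 1).comp ht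
      rw [show κ * |1 - 1 * Real.sqrt 1| = 0 by simp] at h
      exact h
    have h := hA.add hB
    rwa [add_zero] at h
  -- the lower bound: `m = 2/∫𝒱 ≤ ρ_n/e_n`
  set m : ℝ := 2 / ∫ x, 𝒱 x with hm_def
  have hm : 0 < m := by positivity
  have hmle : ∀ n, m ≤ ρs n / es n := fun n => by
    have h := (hsol n).two_mul_le h0 h1 (hρs n).le
    rw [hm_def, div_le_div_iff₀ hIV (hes n)]
    linarith
  -- the violation, normalised: `ε t_n √m < X_n`
  have hkey : ∀ n, ε * t n * Real.sqrt m ≤ X n := by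
    intro n
    have he := hes n
    have hse : 0 < Real.sqrt (es n) := Real.sqrt_pos.2 he
    have hρ := hρs n
    have hv := hviol n
    -- rewrite the printed expression: `b(1 + c√(ρa³)) = b + κ b√b`
    have hid : 2 * Real.pi * ρs n * a * (1 + 128 / (15 * Real.sqrt Real.pi) * Real.sqrt (ρs n * a ^ 3)) =
        b n + κ * (b n * Real.sqrt (b n)) := by
      rw [mul_add, mul_one, lhy_bookkeeping ha hρ]
    rw [hid] at hv
    -- divide by `e√e`
    have hden : 0 < es n * Real.sqrt (es n) := by positivity
    have hlhs : ε * (2 * Real.pi * ρs n * a) * Real.sqrt (ρs n) / (es n * Real.sqrt (es n)) =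
        ε * t n * Real.sqrt (ρs n / es n) := by
      rw [ht_def, Real.sqrt_div' _ he.le]
      simp only [hb_def]
      set r := Real.sqrt (es n) with hr_def
      have hr0 : r ≠ 0 := hse.ne'
      have hr2 : es n = r ^ 2 := (Real.sq_sqrt he.le).symm
      rw [hr2]
      field_simp
    have hrhs : |es n - (b n + κ * (b n * Real.sqrt (b n)))| / (es n * Real.sqrt (es n)) =
        |Q n - κ * (t n * Real.sqrt (t n))| := by
      rw [← abs_of_pos hden, ← abs_div]
      congr 1
      rw [hQ_def, ht_def]
      simp only
      rw [Real.sqrt_div' _ he.le]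
      set r := Real.sqrt (es n) with hr_def
      have hr0 : r ≠ 0 := hse.ne'
      have hr2 : es n = r ^ 2 := (Real.sq_sqrt he.le).symm
      rw [hr2]
      field_simp
      ring
    have hv' : ε * t n * Real.sqrt (ρs n / es n) < |Q n - κ * (t n * Real.sqrt (t n))| := by
      rw [← hlhs, ← hrhs]
      exact div_lt_div_of_pos_right hv hden
    have ht0 : 0 ≤ t n := by rw [ht_def]; exact (div_pos (hb0 n) he).le
    calc ε * t n * Real.sqrt m ≤ ε * t n * Real.sqrt (ρs n / es n) :=
          mul_le_mul_of_nonneg_left (Real.sqrt_le_sqrt (hmle n)) (by positivity)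
      _ ≤ |Q n - κ * (t n * Real.sqrt (t n))| := hv'.le
      _ = |(Q n - κ) + κ * (1 - t n * Real.sqrt (t n))| := by ring_nf
      _ ≤ |Q n - κ| + |κ * (1 - t n * Real.sqrt (t n))| := abs_add_le _ _
      _ = X n := by rw [hX_def]; simp only; rw [abs_mul, abs_of_nonneg hκ0]
  -- pass to the limit: `ε √m ≤ 0`
  have hL : Tendsto (fun n => ε * t n * Real.sqrt m) atTop (𝓝 (ε * 1 * Real.sqrt m)) :=
    (ht.const_mul ε).mul_const _
  have hle := le_of_tendsto_of_tendsto' hL hX hkey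
  have : 0 < ε * 1 * Real.sqrt m := by positivity
  linarith

end Assembly

/-- **CJL-I Theorem 2 (asymptotics of the energy, `d = 3`) holds** (`CarlenJauslinLieb2020_thm2`).
The first sentence (for each `ρ > 0` an `e > 0` with `ρ = ρ(e)`) and the high-density half are the
theorems `CarlenJauslinLieb2020_thm2_exists_of_thm1` (with `CarlenJauslinLieb2020_thm1_holds`) and
`CarlenJauslinLieb2020_thm2_highDensity` of `LiebSimpleEquationFactsProofs.lean`; the low-density
half is `lowDensity_of_measurable` (CJL-I §3.2) after replacing `𝒱` by a measurable modification.
[cite: CarlenJauslinLieb2020, Theorem 2 and §3] -/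
theorem CarlenJauslinLieb2020_thm2_holds : CarlenJauslinLieb2020_thm2 := by
  intro 𝒱 h0 h1 h2 hpos
  refine ⟨CarlenJauslinLieb2020_thm2_exists_of_thm1 CarlenJauslinLieb2020_thm1_holds 𝒱 h0 h1 h2 hpos,
    ?_, CarlenJauslinLieb2020_thm2_highDensity 𝒱 h0 h1 h2⟩
  -- a non-negative measurable modification of the potential
  set 𝒱m : Space → ℝ := fun x => max (h1.1.mk 𝒱 x) 0 with h𝒱m
  have hae : 𝒱 =ᵐ[volume] 𝒱m := by
    filter_upwards [h1.1.ae_eq_mk] with x hx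
    rw [h𝒱m]
    simp only
    rw [← hx, max_eq_left (h0 x)]
  have hVm : Measurable 𝒱m := h1.1.stronglyMeasurable_mk.measurable.max measurable_const
  have h0m : ∀ x, 0 ≤ 𝒱m x := fun x => le_max_right _ _
  have h1m : Integrable 𝒱m := h1.congr hae
  have h2m : MemLp 𝒱m 2 := h2.ae_eq hae
  have hposm : 0 < ∫ x, 𝒱m x := by rwa [← integral_congr_ae hae]
  set φ : Space → ℝ := fun x => (𝛗[𝐕[𝒱m]] x).toReal with hφ_def
  have hφ : IsScatteringSolution 𝒱m φ := isScatteringSolution_scat hVm h0m h1m h2m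
  have hsl : scatteringLengthOf 𝒱 φ = scatteringLengthOf 𝒱m φ := by
    unfold scatteringLengthOf
    congr 1
    refine integral_congr_ae ?_
    filter_upwards [hae] with x hx
    rw [hx]
  refine ⟨φ, ⟨hφ.nonneg, hφ.le_one, fun x => ?_⟩, fun ε hε => ?_⟩
  · rw [hφ.mild x]
    refine conv_congr_ae EventuallyEq.rfl ?_ x
    filter_upwards [hae] with y hy
    rw [hy]
  · obtain ⟨ρ₀, hρ₀, h⟩ := lowDensity_of_measurable hVm h0m h1m h2m hposm ε hε
    refine ⟨ρ₀, hρ₀, fun ρ e u hρ hρlt he hu => ?_⟩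
    rw [hsl]
    exact h ρ e u hρ hρlt he (hu.congr_pot_ae hae)

end LiebSimpleEquation

end Literature.MathematicalPhysics.QuantumManyBody
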